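import Literature.Probability.Process.BurkholderMajorantPieces
import HarnessLib

/-!
# Burkholder's majorant `u_λ` is concave along lines with `|k| < |h|` (LNM 1464, §8, proof of (8.10))

Probability/Process proof file (THEOREMS only: no definition, no named fact, no `sorry`; D-0014).
Search for candidate a priori estimates; no regularity claim (cell `pub-nsfunc`, literature seat:
this file formalises a PUBLISHED argument; nothing new).  It PROVES the concavity clause of the
tree's named fact `Burkholder1991_keyFunction` (`BurkholderSubordination.lean`):

* `burkholderU_concaveOn` — for every real inner product space `E`, `λ > 2`, `x, y, h, k ∈ E` with
  `‖x‖ ≤ 1`, `‖x + h‖ ≤ 1`, `‖k‖ < ‖h‖`, the function `t ↦ u_λ(x + th, y + tk)` is concave on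
  `I = {t : ‖x + th‖ ≤ 1}` (Burkholder: "The function `G` is concave on `I`. This follows from
  (8.15), (8.16), and the continuity of `G`."); the `ℝ⁶` instance is the typed hypothesis
  `Laminate.BurkConcave` of the pub-nsfunc laminate cap `L-CAP-B`
  (`Summits/NavierStokesRegularity/FunctionalMining/StretchingLaminateBurkholderConcave.lean`),
  which thereby becomes unconditional.  `Burkholder1991.burkholderU_concaveOn_line` is the same
  statement without the two (unused) hypotheses `‖x‖ ≤ 1`, `‖x + h‖ ≤ 1`.

The proof follows the printed one, localised: instead of the global finiteness of the exceptional
set `K` and a global gluing, we prove at every interior point of `I` the LOCAL consequence of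
(8.14)–(8.16) — `G(t - s) + G(t + s) ≤ 2G(t)` for all small `s > 0` — and conclude by a
maximum-principle criterion for concavity (`Burkholder1991.concaveOn_of_midpoint_le`, folklore:
a lower semicontinuous function with this local midpoint property on a real interval is concave).
Ingredients, in order:
* scalar curves along a line (`|x+th|², |x+th|, (x+th)·h` and their derivatives); eventual
  non-vanishing of real polynomials near `0⁺` and constant sign by the intermediate value theorem;
* REGION DETERMINATION (`eventually_mem_region`): just to the right of an interior point the line
  stays in ONE of `D₀,…,D₄` — the printed finiteness of `K` ("the zero set of a fourth-degree
  polynomial with leading coefficient `|h|² - |k|²`");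
* the values of `u` on the closures of the regions (continuity of `u` inside `S`) and the KINK
  inequality (8.16) `G'(t₀-) ≥ G'(t₀+)` across `∂D₂ ∩ ∂D₃`, `∂D₃ ∩ ∂D₄` (`slope_right_le_slope_left`);
* one-sided TANGENT bounds from (8.14)–(8.15) (`G'' ≤ 0` on the open regions, file
  `BurkholderMajorantPieces`): `piece_le_tangent`, `right_structure`, whence `midpoint_sum_le`
  and the continuity of `G` at interior points (`continuousAt_line`);
* the endpoints `|x + th| = 1` of `I`: lower semicontinuity of `G` there, by (8.9) at the corner
  `|y + tk| = λ` (`corner_le_eventually`), `u ≥ 0` on `S`, and `u = 1` above `∂D₄`;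
* assembly (`burkholderU_concaveOn_line`).

## References

* [Burkholder1991] D. L. Burkholder, *Explorations in martingale theory and its applications*,
  École d'Été de Probabilités de Saint-Flour XIX—1989, Lecture Notes in Math. 1464, Springer
  1991, pp. 1–66 — §8, proof of Thm. 8.1: (8.9), the proof of (8.10) ((8.11)–(8.16): "The
  function `G` is concave on `I`").
-/

noncomputable section

open Set Filter Topology

open scoped InnerProductSpace

namespace Literature.Probability.Process

namespace Burkholder1991

open Region

/-! ## Lines in a real inner product space: the scalar curves `|x+th|`, `|y+tk|`, `(x+th)·h` -/

section Curves

variable {E : Type*} [NormedAddCommGroup E] [InnerProductSpace ℝ E]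

/-- `|x + th|² = |x|² + 2t x·h + t²|h|²`. [folklore] -/
private theorem norm_add_smul_sq (x h : E) (t : ℝ) :
    ‖x + t • h‖ ^ 2 = ‖x‖ ^ 2 + 2 * t * ⟪x, h⟫_ℝ + t ^ 2 * ‖h‖ ^ 2 := by
  rw [norm_add_sq_real, inner_smul_right, norm_smul, mul_pow, Real.norm_eq_abs, sq_abs]
  ring

/-- `(x + th)·h = x·h + t|h|²`. [folklore] -/
private theorem inner_add_smul_self (x h : E) (t : ℝ) :
    ⟪x + t • h, h⟫_ℝ = ⟪x, h⟫_ℝ + t * ‖h‖ ^ 2 := by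
  rw [inner_add_left, real_inner_smul_left, real_inner_self_eq_norm_sq]

/-- The line `t ↦ x + th` has derivative `h`. [folklore] -/
private theorem hasDerivAt_line (x h : E) (s : ℝ) : HasDerivAt (fun σ : ℝ => x + σ • h) h s := by
  simpa using ((hasDerivAt_id s).smul_const h).const_add x

/-- `(d/dt) (x+th)·h = |h|²`. [folklore] -/
private theorem hasDerivAt_inner_line (x h : E) (s : ℝ) :
    HasDerivAt (fun σ : ℝ => ⟪x + σ • h, h⟫_ℝ) (‖h‖ ^ 2) s := by
  have h1 : HasDerivAt (fun σ : ℝ => ⟪x, h⟫_ℝ + σ * ‖h‖ ^ 2) (1 * ‖h‖ ^ 2) s :=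
    ((hasDerivAt_id s).mul_const (‖h‖ ^ 2)).const_add _
  rw [one_mul] at h1
  refine h1.congr_of_eventuallyEq (Eventually.of_forall fun σ => ?_)
  simp only [inner_add_smul_self]

/-- `(d/dt) |x+th|² = 2 (x+th)·h`. [folklore] -/
private theorem hasDerivAt_norm_sq_line (x h : E) (s : ℝ) :
    HasDerivAt (fun σ : ℝ => ‖x + σ • h‖ ^ 2) (2 * ⟪x + s • h, h⟫_ℝ) s :=
  (hasDerivAt_line x h s).norm_sq

/-- `(d/dt) |x+th| = (x+th)·h / |x+th|` where `x + th ≠ 0`. [folklore] -/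
private theorem hasDerivAt_norm_line (x h : E) (s : ℝ) (h0 : x + s • h ≠ 0) :
    HasDerivAt (fun σ : ℝ => ‖x + σ • h‖) (⟪x + s • h, h⟫_ℝ / ‖x + s • h‖) s := by
  have hne : ‖x + s • h‖ ^ 2 ≠ 0 := pow_ne_zero 2 (norm_ne_zero_iff.2 h0)
  have h1 := (hasDerivAt_norm_sq_line x h s).sqrt hne
  have hfun : (fun σ : ℝ => Real.sqrt (‖x + σ • h‖ ^ 2)) = fun σ => ‖x + σ • h‖ := by
    funext σ; exact Real.sqrt_sq (norm_nonneg _)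
  rw [hfun] at h1
  refine h1.congr_deriv ?_
  rw [Real.sqrt_sq (norm_nonneg _)]
  have : ‖x + s • h‖ ≠ 0 := norm_ne_zero_iff.2 h0
  field_simp

/-- Cauchy–Schwarz, squared: `(y·k)² ≤ |y|²|k|²`. [folklore] -/
private theorem inner_sq_le (y k : E) : ⟪y, k⟫_ℝ ^ 2 ≤ ‖y‖ ^ 2 * ‖k‖ ^ 2 := by
  have h := abs_real_inner_le_norm y k
  calc ⟪y, k⟫_ℝ ^ 2 = |⟪y, k⟫_ℝ| ^ 2 := (sq_abs _).symm
    _ ≤ (‖y‖ * ‖k‖) ^ 2 := pow_le_pow_left₀ (abs_nonneg _) h 2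
    _ = ‖y‖ ^ 2 * ‖k‖ ^ 2 := by ring

/-- Translation along the line: `x + (t+s)h = (x + th) + sh`. [folklore] -/
private theorem add_add_smul (x h : E) (t s : ℝ) : x + (t + s) • h = (x + t • h) + s • h := by
  rw [add_smul, add_assoc]

/-- Reflection along the line: `x + (t-s)h = (x + th) + s(-h)`. [folklore] -/
private theorem add_sub_smul (x h : E) (t s : ℝ) : x + (t - s) • h = (x + t • h) + s • (-h) := by
  rw [sub_smul, smul_neg, sub_eq_add_neg, add_assoc]

end Curves

/-! ## One-variable lemmas: eventual signs near `0⁺`, one-sided tangents, and a concavity criterion -/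

section OneVariable

/-- From a filter statement on `𝓝[>] 0` to an interval `(0, δ)`. [folklore] -/
private theorem exists_Ioo_of_eventually {P : ℝ → Prop} (h : ∀ᶠ s in 𝓝[>] (0:ℝ), P s) :
    ∃ δ > 0, ∀ s ∈ Ioo (0:ℝ) δ, P s := by
  rw [eventually_nhdsWithin_iff, Metric.eventually_nhds_iff] at h
  obtain ⟨ε, hε, hP⟩ := h
  refine ⟨ε, hε, fun s hs => hP ?_ hs.1⟩
  rw [Real.dist_eq, sub_zero, abs_of_pos hs.1]
  exact hs.2

/-- From an interval `(0, δ)` to a filter statement on `𝓝[>] 0`. [folklore] -/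
private theorem eventually_of_Ioo {P : ℝ → Prop} {δ : ℝ} (hδ : 0 < δ) (h : ∀ s ∈ Ioo (0:ℝ) δ, P s) :
    ∀ᶠ s in 𝓝[>] (0:ℝ), P s := by
  filter_upwards [Ioo_mem_nhdsGT hδ] with s hs using h s hs

/-- A nonzero real polynomial does not vanish on some `(0, δ)`. [folklore] -/
private theorem eventually_eval_ne_zero {p : Polynomial ℝ} (hp : p ≠ 0) :
    ∀ᶠ s in 𝓝[>] (0:ℝ), p.eval s ≠ 0 := by
  have hF : Set.Finite ({x : ℝ | p.IsRoot x} \ {0}) := (Polynomial.finite_setOf_isRoot hp).sdiff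
  have hopen : IsOpen (({x : ℝ | p.IsRoot x} \ {0})ᶜ) := hF.isClosed.isOpen_compl
  have h0 : (0:ℝ) ∈ ({x : ℝ | p.IsRoot x} \ {0})ᶜ := by simp
  have hnhds := hopen.mem_nhds h0
  have h1 : ∀ᶠ s in 𝓝[>] (0:ℝ), s ∈ ({x : ℝ | p.IsRoot x} \ {0})ᶜ :=
    mem_nhdsWithin_of_mem_nhds hnhds
  have h2 : ∀ᶠ s in 𝓝[>] (0:ℝ), s ∈ Ioi (0:ℝ) := self_mem_nhdsWithin
  filter_upwards [h1, h2] with s hs hs2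
  intro hroot
  have hmem : s ∈ ({x : ℝ | p.IsRoot x} \ {0}) := ⟨hroot, fun h0 => (ne_of_gt hs2) h0⟩
  exact hs hmem

/-- A quartic with nonzero leading coefficient does not vanish on some `(0, δ)`. [folklore] -/
private theorem eventually_quartic_ne_zero (c0 c1 c2 c3 c4 : ℝ) (h4 : c4 ≠ 0) :
    ∀ᶠ s in 𝓝[>] (0:ℝ), c0 + c1 * s + c2 * s ^ 2 + c3 * s ^ 3 + c4 * s ^ 4 ≠ 0 := by
  let p : Polynomial ℝ := Polynomial.C c0 + Polynomial.C c1 * Polynomial.X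
    + Polynomial.C c2 * Polynomial.X ^ 2 + Polynomial.C c3 * Polynomial.X ^ 3
    + Polynomial.C c4 * Polynomial.X ^ 4
  have hp : p ≠ 0 := by
    intro h
    have hc : p.coeff 4 = c4 := by
      simp only [p, Polynomial.coeff_add, Polynomial.coeff_C_mul, Polynomial.coeff_X_pow,
        Polynomial.coeff_C, Polynomial.coeff_X]
      norm_num
    rw [h, Polynomial.coeff_zero] at hc
    exact h4 hc.symm
  filter_upwards [eventually_eval_ne_zero hp] with s hs
  have he : p.eval s = c0 + c1 * s + c2 * s ^ 2 + c3 * s ^ 3 + c4 * s ^ 4 := by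
    simp only [p, Polynomial.eval_add, Polynomial.eval_mul, Polynomial.eval_C, Polynomial.eval_pow,
      Polynomial.eval_X]
  rwa [he] at hs

/-- A quadratic with nonzero leading coefficient does not vanish on some `(0, δ)`. [folklore] -/
private theorem eventually_quadratic_ne_zero (c0 c1 c2 : ℝ) (h2 : c2 ≠ 0) :
    ∀ᶠ s in 𝓝[>] (0:ℝ), c0 + c1 * s + c2 * s ^ 2 ≠ 0 := by
  let p : Polynomial ℝ := Polynomial.C c0 + Polynomial.C c1 * Polynomial.X
    + Polynomial.C c2 * Polynomial.X ^ 2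
  have hp : p ≠ 0 := by
    intro h
    have hc : p.coeff 2 = c2 := by
      simp only [p, Polynomial.coeff_add, Polynomial.coeff_C_mul, Polynomial.coeff_X_pow,
        Polynomial.coeff_C, Polynomial.coeff_X]
      norm_num
    rw [h, Polynomial.coeff_zero] at hc
    exact h2 hc.symm
  filter_upwards [eventually_eval_ne_zero hp] with s hs
  have he : p.eval s = c0 + c1 * s + c2 * s ^ 2 := by
    simp only [p, Polynomial.eval_add, Polynomial.eval_mul, Polynomial.eval_C, Polynomial.eval_pow,
      Polynomial.eval_X]
  rwa [he] at hs

/-- A continuous function with no zeros on `(0, δ)` has a constant sign there (intermediate value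
theorem). [folklore] -/
private theorem eventually_pos_or_neg {g : ℝ → ℝ} (hg : Continuous g) (h : ∀ᶠ s in 𝓝[>] (0:ℝ), g s ≠ 0) :
    (∀ᶠ s in 𝓝[>] (0:ℝ), 0 < g s) ∨ (∀ᶠ s in 𝓝[>] (0:ℝ), g s < 0) := by
  obtain ⟨δ, hδ, hne⟩ := exists_Ioo_of_eventually h
  by_cases hpos : ∀ s ∈ Ioo (0:ℝ) δ, 0 < g s
  · exact Or.inl (eventually_of_Ioo hδ hpos)
  · right
    push Not at hpos
    obtain ⟨s₁, hs₁, hg₁⟩ := hpos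
    have hg₁' : g s₁ < 0 := lt_of_le_of_ne hg₁ (hne s₁ hs₁)
    apply eventually_of_Ioo hδ
    intro s hs
    rcases lt_or_gt_of_ne (hne s hs) with hlt | hgt
    · exact hlt
    · exfalso
      -- a zero between `s₁` and `s`
      have hsub : uIcc s₁ s ⊆ Ioo (0:ℝ) δ := ordConnected_Ioo.uIcc_subset hs₁ hs
      have hivt := intermediate_value_uIcc (hg.continuousOn (s := uIcc s₁ s))
      have h0 : (0:ℝ) ∈ uIcc (g s₁) (g s) := by
        rw [mem_uIcc]; exact Or.inl ⟨hg₁'.le, hgt.le⟩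
      obtain ⟨c, hc, hgc⟩ := hivt h0
      exact hne c (hsub hc) hgc

/-- If `g(0) = 0`, `g` is differentiable at `0` and `g ≥ 0` just to the right of `0`, then
`g'(0) ≥ 0`. [folklore] -/
private theorem deriv_nonneg_of_eventually_nonneg {g : ℝ → ℝ} {g' : ℝ} (hg : HasDerivAt g g' 0)
    (h0 : g 0 = 0) (h : ∀ᶠ s in 𝓝[>] (0:ℝ), 0 ≤ g s) : 0 ≤ g' := by
  have ht := hg.tendsto_slope_zero_right
  refine ge_of_tendsto ht ?_
  filter_upwards [h, self_mem_nhdsWithin] with s hs hs0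
  rw [zero_add, h0, sub_zero, smul_eq_mul]
  exact mul_nonneg (inv_nonneg.2 (le_of_lt hs0)) hs

/-- If `g(0) = 0`, `g` is differentiable at `0` and `g ≤ 0` just to the right of `0`, then
`g'(0) ≤ 0`. [folklore] -/
private theorem deriv_nonpos_of_eventually_nonpos {g : ℝ → ℝ} {g' : ℝ} (hg : HasDerivAt g g' 0)
    (h0 : g 0 = 0) (h : ∀ᶠ s in 𝓝[>] (0:ℝ), g s ≤ 0) : g' ≤ 0 := by
  have := deriv_nonneg_of_eventually_nonneg hg.neg (by simp [h0])
    (by filter_upwards [h] with s hs; simpa using hs)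
  linarith

/-- Passing to the limit `s → 0⁺` in an inequality. [folklore] -/
private theorem nonneg_of_eventually_nonneg {g : ℝ → ℝ} (hg : ContinuousAt g 0)
    (h : ∀ᶠ s in 𝓝[>] (0:ℝ), 0 ≤ g s) : 0 ≤ g 0 := by
  have ht : Tendsto g (𝓝[>] (0:ℝ)) (𝓝 (g 0)) := hg.tendsto.mono_left nhdsWithin_le_nhds
  exact ge_of_tendsto ht h

/-- **One-sided tangent bound.** If `Φ` is continuous on `[0, δ)` with derivative `ψ` on `(0, δ)`,
`ψ` continuous on `[0, δ)` with derivative `χ ≤ 0` on `(0, δ)`, then `Φ(s) ≤ Φ(0) + ψ(0)s` on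
`[0, δ)` (the graph lies below the one-sided tangent). [folklore] -/
private theorem le_tangent_of_deriv2_nonpos {Φ ψ χ : ℝ → ℝ} {δ : ℝ} (hδ : 0 < δ)
    (hΦ : ContinuousOn Φ (Ico 0 δ)) (hψ : ContinuousOn ψ (Ico 0 δ))
    (hd1 : ∀ s ∈ Ioo 0 δ, HasDerivAt Φ (ψ s) s) (hd2 : ∀ s ∈ Ioo 0 δ, HasDerivAt ψ (χ s) s)
    (hχ : ∀ s ∈ Ioo 0 δ, χ s ≤ 0) : ∀ s ∈ Ico 0 δ, Φ s ≤ Φ 0 + ψ 0 * s := by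
  have hint : interior (Ico (0:ℝ) δ) = Ioo 0 δ := interior_Ico
  have hanti : AntitoneOn ψ (Ico 0 δ) := by
    refine antitoneOn_of_deriv_nonpos (convex_Ico 0 δ) hψ ?_ ?_
    · rw [hint]; exact fun s hs => (hd2 s hs).differentiableAt.differentiableWithinAt
    · rw [hint]; intro s hs; rw [(hd2 s hs).deriv]; exact hχ s hs
  have h0 : (0:ℝ) ∈ Ico 0 δ := left_mem_Ico.2 hδ
  intro s hs
  have hle : Φ s - Φ 0 ≤ ψ 0 * (s - 0) := by
    refine (convex_Ico 0 δ).image_sub_le_mul_sub_of_deriv_le hΦ ?_ ?_ 0 h0 s hs hs.1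
    · rw [hint]; exact fun s hs => (hd1 s hs).differentiableAt.differentiableWithinAt
    · rw [hint]; intro σ hσ; rw [(hd1 σ hσ).deriv]
      exact hanti h0 (Ioo_subset_Ico_self hσ) hσ.1.le
  linarith

/-- **Concavity criterion (maximum principle).** Let `D ⊆ ℝ` be convex and `G` lower
semicontinuous on `D` (within `D`). If at every point `t` lying strictly between two points of
`D` one has `G(t-s) + G(t+s) ≤ 2G(t)` for all small `s > 0`, then `G` is concave on `D`.
(Proof: for `ε > 0` the function `G - εt² - (chord)` attains its minimum on `[p, q]` at an
interior point, where the local midpoint inequality is violated; let `ε → 0`.) [folklore] -/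
private theorem concaveOn_of_midpoint_le {D : Set ℝ} (hD : Convex ℝ D) {G : ℝ → ℝ}
    (hlsc : LowerSemicontinuousOn G D)
    (hmid : ∀ ⦃p t q : ℝ⦄, p ∈ D → q ∈ D → p < t → t < q →
      ∀ᶠ s in 𝓝[>] (0:ℝ), G (t - s) + G (t + s) ≤ 2 * G t) :
    ConcaveOn ℝ D G := by
  -- the key inequality for `p < q`
  have key : ∀ ⦃p q : ℝ⦄, p ∈ D → q ∈ D → p < q → ∀ ⦃a b : ℝ⦄, 0 < a → 0 < b → a + b = 1 →
      a * G p + b * G q ≤ G (a * p + b * q) := by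
    intro p q hp hq hpq a b ha hb hab
    by_contra hcon
    push Not at hcon
    set r := a * p + b * q with hr
    have hqp : 0 < q - p := by linarith
    have hpr : p < r := by
      have h1 : r - p = b * (q - p) := by rw [hr]; linear_combination p * hab
      have h2 : 0 < b * (q - p) := mul_pos hb hqp
      linarith
    have hrq : r < q := by
      have h1 : q - r = a * (q - p) := by rw [hr]; linear_combination (-q) * hab
      have h2 : 0 < a * (q - p) := mul_pos ha hqp
      linarith
    set gap := a * G p + b * G q - G r with hgap
    have hgap0 : 0 < gap := by rw [hgap]; linarith
    set ε := gap / (2 * (q - p) ^ 2) with hε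
    have hε0 : 0 < ε := by rw [hε]; positivity
    have hεqp : ε * (q - p) ^ 2 = gap / 2 := by rw [hε]; field_simp
    -- the chord of `G - ε t²` on `[p, q]`
    set m := ((G q - ε * q ^ 2) - (G p - ε * p ^ 2)) / (q - p) with hm
    set ψ : ℝ → ℝ := fun t => G t + (-(ε * t ^ 2) - ((G p - ε * p ^ 2) + m * (t - p))) with hψ
    have hψp : ψ p = 0 := by simp only [hψ]; ring
    have hψq : ψ q = 0 := by
      simp only [hψ, hm]; field_simp; ring
    have hIcc : Icc p q ⊆ D := by
      rw [← segment_eq_Icc hpq.le]; exact hD.segment_subset hp hq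
    -- `ψ r < 0`
    have hψr : ψ r < 0 := by
      have hb' : r - p = b * (q - p) := by
        rw [hr]; have ha' : a = 1 - b := by linarith
        rw [ha']; ring
      have hmr : (G p - ε * p ^ 2) + m * (r - p)
          = a * (G p - ε * p ^ 2) + b * (G q - ε * q ^ 2) := by
        rw [hb', hm]
        have ha' : a = 1 - b := by linarith
        rw [ha']
        field_simp
        ring
      have hconv : a * p ^ 2 + b * q ^ 2 - r ^ 2 = a * b * (q - p) ^ 2 := by
        rw [hr]
        have ha' : a = 1 - b := by linarith
        rw [ha']; ring
      have hab4 : a * b * (q - p) ^ 2 ≤ (q - p) ^ 2 := by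
        have : a * b ≤ 1 := by nlinarith
        nlinarith [sq_nonneg (q - p)]
      have : ψ r = -gap + ε * (a * p ^ 2 + b * q ^ 2 - r ^ 2) := by
        simp only [hψ]; rw [hmr, hgap]; ring
      rw [this, hconv]
      nlinarith [hεqp, mul_le_mul_of_nonneg_left hab4 hε0.le]
    -- `ψ` is lower semicontinuous on `[p, q]`, hence attains its minimum at some `t₀`
    have hψlsc : LowerSemicontinuousOn ψ (Icc p q) := by
      have h1 : LowerSemicontinuousOn G (Icc p q) := hlsc.mono hIcc
      have h2 : LowerSemicontinuousOn
          (fun t : ℝ => -(ε * t ^ 2) - ((G p - ε * p ^ 2) + m * (t - p))) (Icc p q) :=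
        (Continuous.lowerSemicontinuous (by fun_prop)).lowerSemicontinuousOn _
      exact h1.add h2
    obtain ⟨t₀, ht₀, hmin⟩ := hψlsc.exists_isMinOn (nonempty_Icc.2 hpq.le) isCompact_Icc
    rw [isMinOn_iff] at hmin
    have hψt₀ : ψ t₀ < 0 := lt_of_le_of_lt (hmin r ⟨hpr.le, hrq.le⟩) hψr
    have ht₀p : p < t₀ := by
      rcases eq_or_lt_of_le ht₀.1 with h | h
      · rw [← h, hψp] at hψt₀; exact absurd hψt₀ (lt_irrefl 0)
      · exact h
    have ht₀q : t₀ < q := by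
      rcases eq_or_lt_of_le ht₀.2 with h | h
      · rw [h, hψq] at hψt₀; exact absurd hψt₀ (lt_irrefl 0)
      · exact h
    -- a small `s > 0` with `t₀ ± s ∈ [p, q]` and the local midpoint inequality
    have hev := hmid hp hq ht₀p ht₀q
    have hev2 : ∀ᶠ s in 𝓝[>] (0:ℝ), s ∈ Ioo (0:ℝ) (min (t₀ - p) (q - t₀)) :=
      Ioo_mem_nhdsGT (lt_min (by linarith) (by linarith))
    obtain ⟨s, hsG, hs⟩ := (hev.and hev2).exists
    have hs0 : 0 < s := hs.1
    have hs1 : s < t₀ - p := lt_of_lt_of_le hs.2 (min_le_left _ _)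
    have hs2 : s < q - t₀ := lt_of_lt_of_le hs.2 (min_le_right _ _)
    have hm1 := hmin (t₀ - s) ⟨by linarith, by linarith⟩
    have hm2 := hmin (t₀ + s) ⟨by linarith, by linarith⟩
    have hexp : ψ (t₀ - s) + ψ (t₀ + s) - 2 * ψ t₀
        = (G (t₀ - s) + G (t₀ + s) - 2 * G t₀) - 2 * ε * s ^ 2 := by
      simp only [hψ]; ring
    have hεs : 0 < 2 * ε * s ^ 2 := by positivity
    linarith
  -- assemble
  refine ⟨hD, ?_⟩
  intro x hx y hy a b ha hb hab
  simp only [smul_eq_mul]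
  rcases ha.eq_or_lt with ha0 | ha0
  · rw [← ha0] at hab ⊢
    simp only [zero_add] at hab
    rw [hab]; simp
  rcases hb.eq_or_lt with hb0 | hb0
  · rw [← hb0] at hab ⊢
    simp only [add_zero] at hab
    rw [hab]; simp
  rcases lt_trichotomy x y with hxy | hxy | hxy
  · exact key hx hy hxy ha0 hb0 hab
  · subst hxy
    have h1 : a * G x + b * G x = G x := by rw [← add_mul, hab, one_mul]
    have h2 : a * x + b * x = x := by rw [← add_mul, hab, one_mul]
    rw [h1, h2]
  · have := key hy hx hxy hb0 ha0 (by linarith)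
    rw [add_comm (b * G y), add_comm (b * y)] at this
    exact this

end OneVariable


/-! ## `u` near a boundary point: values of the glued formulas (continuity of `u` inside `S`) -/

section Values

/-- Closure of `D₀`: `u = f0`. [cite: Burkholder1991, §8 ("the restriction of `u` to the interior of `S` is continuous")] -/
theorem uR_eq_f0_of_le {lam a b : ℝ} (hlam : 2 < lam) (ha0 : 0 ≤ a) (ha : a < 1) (hb : 0 ≤ b)
    (h : a + b ≤ 1) : uR lam a b = f0 lam a b := by
  rcases h.lt_or_eq with h1 | h1
  · exact uR_eq_piece hlam ha0 hb (r := .D0) ⟨h1, ha⟩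
  · have hb1 : b ^ 2 ≤ (1 - a) ^ 2 := pow_le_pow_left₀ hb (by linarith) 2
    have hl2 : 4 < lam ^ 2 := by nlinarith
    have hb2 : ¬ lam ^ 2 - 1 + a ^ 2 < b ^ 2 := by intro hc; nlinarith
    unfold uR
    rw [if_neg ha.ne, if_neg hb2, if_neg (by linarith), if_neg (by linarith), if_pos h1.ge]
    exact (f0_eq_f1 h1).symm

/-- Closure of `D₁`: `u = f1`. [cite: Burkholder1991, §8 (continuity of `u`)] -/
theorem uR_eq_f1_of_le {lam a b : ℝ} (hlam : 2 < lam) (ha0 : 0 ≤ a) (ha : a < 1) (hb : 0 ≤ b)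
    (h1 : 1 ≤ a + b) (h2 : a + b ≤ lam - 1) : uR lam a b = f1 lam a b := by
  have hc : 0 ≤ lam - 1 - a := by linarith
  have hb1 : b ^ 2 ≤ (lam - 1 - a) ^ 2 := pow_le_pow_left₀ hb (by linarith) 2
  have hb2 : ¬ lam ^ 2 - 1 + a ^ 2 < b ^ 2 := by intro hc'; nlinarith
  unfold uR
  rw [if_neg ha.ne, if_neg hb2]
  by_cases h3 : lam - 1 + a ≤ b
  · -- the corner `a = 0`, `b = λ - 1`
    have ha' : a = 0 := by linarith
    have hb' : b = lam - 1 := by linarith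
    rw [if_pos h3]
    subst ha'
    rw [← f2_eq_f3 (by linarith) (by norm_num) (by rw [hb']; ring),
      ← f1_eq_f2 le_rfl (by rw [hb']; ring)]
  rw [if_neg h3]
  by_cases h4 : lam - 1 - a ≤ b
  · rw [if_pos h4]
    exact (f1_eq_f2 ha0 (by linarith)).symm
  · rw [if_neg h4, if_pos h1]

/-- Closure of `D₂`: `u = f2`. [cite: Burkholder1991, §8 (continuity of `u`)] -/
theorem uR_eq_f2_of_le {lam a b : ℝ} (hlam : 2 < lam) (ha0 : 0 ≤ a) (ha : a < 1) (hb : 0 ≤ b)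
    (h1 : lam - 1 - a ≤ b) (h2 : b ≤ lam - 1 + a) : uR lam a b = f2 lam a b := by
  have hc : 0 < lam - 1 + a := by linarith
  have hb1 : b ^ 2 ≤ (lam - 1 + a) ^ 2 := pow_le_pow_left₀ hb h2 2
  have hb2 : ¬ lam ^ 2 - 1 + a ^ 2 < b ^ 2 := by
    have := sq_boundary_lt (show (1:ℝ) < lam by linarith) ha
    intro hc'; linarith
  unfold uR
  rw [if_neg ha.ne, if_neg hb2]
  by_cases h3 : lam - 1 + a ≤ b
  · rw [if_pos h3]
    exact (f2_eq_f3 (by linarith) ha (le_antisymm h2 h3)).symm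
  · rw [if_neg h3, if_pos h1]

/-- Closure of `D₃`: `u = f3`. [cite: Burkholder1991, §8 (continuity of `u`)] -/
theorem uR_eq_f3_of_le {lam a b : ℝ} (ha : a < 1) (h1 : lam - 1 + a ≤ b)
    (h2 : b ^ 2 ≤ lam ^ 2 - 1 + a ^ 2) : uR lam a b = f3 lam a b := by
  unfold uR
  rw [if_neg ha.ne, if_neg (not_lt.2 h2), if_pos h1]

/-- Closure of `D₄`: `u = 1`. [cite: Burkholder1991, §8 (continuity of `u`)] -/
theorem uR_eq_one_of_le {lam a b : ℝ} (hlam : 2 < lam) (ha : a < 1) (hb : 0 ≤ b)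
    (h1 : lam ^ 2 - 1 + a ^ 2 ≤ b ^ 2) : uR lam a b = 1 := by
  unfold uR
  rw [if_neg ha.ne]
  rcases h1.lt_or_eq with h | h
  · rw [if_pos h]
  · rw [if_neg (by rw [h]; exact lt_irrefl _)]
    have h3 : lam - 1 + a ≤ b := by
      have := sq_boundary_lt (show (1:ℝ) < lam by linarith) ha
      nlinarith
    rw [if_pos h3]
    exact f3_eq_one (by linarith) h.symm

/-- On the closure of `D_i` (limits of points of `D_i`), `u` equals the `i`-th formula: version
with the closure described by non-strict inequalities. [cite: Burkholder1991, §8 (continuity of `u`)] -/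
theorem uR_eq_piece_of_closure {lam a b : ℝ} (hlam : 2 < lam) (ha0 : 0 ≤ a) (ha : a < 1)
    (hb : 0 ≤ b) : ∀ (r : Region),
    (match r with
      | .D0 => a + b ≤ 1
      | .D1 => 1 ≤ a + b ∧ a + b ≤ lam - 1
      | .D2 => lam - 1 - a ≤ b ∧ b ≤ lam - 1 + a
      | .D3 => lam - 1 + a ≤ b ∧ b ^ 2 ≤ lam ^ 2 - 1 + a ^ 2
      | .D4 => lam ^ 2 - 1 + a ^ 2 ≤ b ^ 2) → uR lam a b = r.piece lam a b
  | .D0, h => uR_eq_f0_of_le hlam ha0 ha hb h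
  | .D1, h => uR_eq_f1_of_le hlam ha0 ha hb h.1 h.2
  | .D2, h => uR_eq_f2_of_le hlam ha0 ha hb h.1 h.2
  | .D3, h => uR_eq_f3_of_le ha h.1 h.2
  | .D4, h => uR_eq_one_of_le hlam ha hb h

end Values

/-! ## Region determination: just to the right of any interior point, the line stays in ONE region
("the set `K` … is finite: … the zero set of a fourth-degree polynomial with leading coefficient
`|h|² - |k|²`") -/

section Regions

variable {E : Type*} [NormedAddCommGroup E] [InnerProductSpace ℝ E]

/-- The boundary quartic: if `|k| ≠ |h|` then, for any level `c`,
`(c² + |x+th|² - |y+tk|²)² - 4c²|x+th|² ≠ 0` for all small `t > 0` (it is a quartic in `t` with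
leading coefficient `(|h|² - |k|²)²`); its zero set contains the parameters where
`|x+th| + |y+tk| = c` or `|y+tk| - |x+th| = c`. [cite: Burkholder1991, §8, proof of (8.10) (finiteness of `K`)] -/
theorem eventually_boundary_quartic_ne (x y h k : E) (hhk : ‖k‖ ≠ ‖h‖) (c : ℝ) :
    ∀ᶠ s in 𝓝[>] (0:ℝ),
      (c ^ 2 + ‖x + s • h‖ ^ 2 - ‖y + s • k‖ ^ 2) ^ 2 - 4 * c ^ 2 * ‖x + s • h‖ ^ 2 ≠ 0 := by
  have hu2 : ‖h‖ ^ 2 - ‖k‖ ^ 2 ≠ 0 := by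
    intro h0
    apply hhk
    exact (pow_left_inj₀ (norm_nonneg k) (norm_nonneg h) two_ne_zero).1 (by linarith)
  have key := eventually_quartic_ne_zero
    ((c ^ 2 + ‖x‖ ^ 2 - ‖y‖ ^ 2) ^ 2 - 4 * c ^ 2 * ‖x‖ ^ 2)
    (2 * (c ^ 2 + ‖x‖ ^ 2 - ‖y‖ ^ 2) * (2 * ⟪x, h⟫_ℝ - 2 * ⟪y, k⟫_ℝ) - 8 * c ^ 2 * ⟪x, h⟫_ℝ)
    ((2 * ⟪x, h⟫_ℝ - 2 * ⟪y, k⟫_ℝ) ^ 2 + 2 * (c ^ 2 + ‖x‖ ^ 2 - ‖y‖ ^ 2) * (‖h‖ ^ 2 - ‖k‖ ^ 2)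
      - 4 * c ^ 2 * ‖h‖ ^ 2)
    (2 * (2 * ⟪x, h⟫_ℝ - 2 * ⟪y, k⟫_ℝ) * (‖h‖ ^ 2 - ‖k‖ ^ 2))
    ((‖h‖ ^ 2 - ‖k‖ ^ 2) ^ 2) (pow_ne_zero 2 hu2)
  filter_upwards [key] with s hs
  rw [norm_add_smul_sq, norm_add_smul_sq]
  intro h0
  apply hs
  linear_combination h0

omit [InnerProductSpace ℝ E] in
/-- `h ≠ 0` when `|k| < |h|`. [folklore] -/
private theorem ne_zero_of_norm_lt {h k : E} (hhk : ‖k‖ < ‖h‖) : h ≠ 0 := by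
  intro h0
  rw [h0, norm_zero] at hhk
  exact absurd hhk (not_lt.2 (norm_nonneg k))

/-- **Region determination.** For `|x| < 1`, `|k| < |h|`, `λ > 2`, there is ONE region `D_i`
containing `(x + th, y + tk)` for all small `t > 0`. [cite: Burkholder1991, §8, proof of (8.10) (finiteness of `K`)] -/
theorem eventually_mem_region (lam : ℝ) {x y h k : E} (hx : ‖x‖ < 1) (hhk : ‖k‖ < ‖h‖) :
    ∃ r : Region, ∀ᶠ s in 𝓝[>] (0:ℝ), r.mem lam ‖x + s • h‖ ‖y + s • k‖ := by
  have hne : ‖k‖ ≠ ‖h‖ := hhk.ne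
  have hh0 : h ≠ 0 := ne_zero_of_norm_lt hhk
  -- `|x + th| < 1` for small `t`
  have hA1 : ∀ᶠ s in 𝓝[>] (0:ℝ), ‖x + s • h‖ < 1 := by
    have hc : Continuous fun σ : ℝ => ‖x + σ • h‖ := by fun_prop
    have ht : Tendsto (fun σ : ℝ => ‖x + σ • h‖) (𝓝 0) (𝓝 ‖x + (0:ℝ) • h‖) := hc.tendsto 0
    simp only [zero_smul, add_zero] at ht
    exact (ht.eventually (gt_mem_nhds hx)).filter_mono nhdsWithin_le_nhds
  -- `|x + th| ≠ 0` for small `t > 0`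
  have hA0 : ∀ᶠ s in 𝓝[>] (0:ℝ), ‖x + s • h‖ ≠ 0 := by
    have := eventually_quadratic_ne_zero (‖x‖ ^ 2) (2 * ⟪x, h⟫_ℝ) (‖h‖ ^ 2)
      (pow_ne_zero 2 (norm_ne_zero_iff.2 hh0))
    filter_upwards [this] with s hs
    intro h0
    apply hs
    have e := norm_add_smul_sq x h s
    rw [h0] at e
    linear_combination -e
  -- the four boundary functions do not vanish for small `t > 0`
  have hq1 := eventually_boundary_quartic_ne x y h k hne 1
  have hq2 := eventually_boundary_quartic_ne x y h k hne (lam - 1)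
  have he1 : ∀ᶠ s in 𝓝[>] (0:ℝ), ‖x + s • h‖ + ‖y + s • k‖ - 1 ≠ 0 := by
    filter_upwards [hq1] with s hs
    intro h0
    apply hs
    have hB : ‖y + s • k‖ = 1 - ‖x + s • h‖ := by linarith
    rw [hB]; ring
  have he2 : ∀ᶠ s in 𝓝[>] (0:ℝ), ‖x + s • h‖ + ‖y + s • k‖ - (lam - 1) ≠ 0 := by
    filter_upwards [hq2] with s hs
    intro h0
    apply hs
    have hB : ‖y + s • k‖ = (lam - 1) - ‖x + s • h‖ := by linarith
    rw [hB]; ring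
  have he3 : ∀ᶠ s in 𝓝[>] (0:ℝ), ‖y + s • k‖ - ‖x + s • h‖ - (lam - 1) ≠ 0 := by
    filter_upwards [hq2] with s hs
    intro h0
    apply hs
    have hB : ‖y + s • k‖ = (lam - 1) + ‖x + s • h‖ := by linarith
    rw [hB]; ring
  have he4 : ∀ᶠ s in 𝓝[>] (0:ℝ), ‖y + s • k‖ ^ 2 - ‖x + s • h‖ ^ 2 - (lam ^ 2 - 1) ≠ 0 := by
    have hc2 : ‖k‖ ^ 2 - ‖h‖ ^ 2 ≠ 0 := by
      intro h0
      apply hne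
      exact (pow_left_inj₀ (norm_nonneg k) (norm_nonneg h) two_ne_zero).1 (by linarith)
    have := eventually_quadratic_ne_zero (‖y‖ ^ 2 - ‖x‖ ^ 2 - (lam ^ 2 - 1))
      (2 * ⟪y, k⟫_ℝ - 2 * ⟪x, h⟫_ℝ) (‖k‖ ^ 2 - ‖h‖ ^ 2) hc2
    filter_upwards [this] with s hs
    rw [norm_add_smul_sq, norm_add_smul_sq]
    intro h0
    apply hs
    linear_combination h0
  -- constant signs, and the cascade
  rcases eventually_pos_or_neg (by fun_prop) he4 with h4 | h4
  · refine ⟨.D4, ?_⟩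
    filter_upwards [h4, hA1] with s hs hs1
    exact ⟨by linarith, hs1⟩
  rcases eventually_pos_or_neg (by fun_prop) he3 with h3 | h3
  · refine ⟨.D3, ?_⟩
    filter_upwards [h3, h4, hA1] with s hs hs4 hs1
    exact ⟨by linarith, by linarith, hs1⟩
  rcases eventually_pos_or_neg (by fun_prop) he2 with h2 | h2
  · refine ⟨.D2, ?_⟩
    filter_upwards [h2, h3, hA1] with s hs hs3 hs1
    exact ⟨by linarith, by linarith, hs1⟩
  rcases eventually_pos_or_neg (by fun_prop) he1 with h1 | h1
  · refine ⟨.D1, ?_⟩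
    filter_upwards [h1, h2, hA0, hA1] with s hs hs2 hs0 hs1
    exact ⟨by linarith, by linarith, lt_of_le_of_ne (norm_nonneg _) (Ne.symm hs0), hs1⟩
  · refine ⟨.D0, ?_⟩
    filter_upwards [h1, hA1] with s hs hs1
    exact ⟨by linarith, hs1⟩

/-- The closure conditions at the base point, from membership just to the right (limits `t → 0⁺`;
`η, κ` is the direction). [cite: Burkholder1991, §8 (continuity of `u`)] -/
theorem closure_of_eventually_mem {lam : ℝ} {x y η κ : E} : ∀ {r : Region},
    (∀ᶠ s in 𝓝[>] (0:ℝ), r.mem lam ‖x + s • η‖ ‖y + s • κ‖) →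
    (match r with
      | .D0 => ‖x‖ + ‖y‖ ≤ 1
      | .D1 => 1 ≤ ‖x‖ + ‖y‖ ∧ ‖x‖ + ‖y‖ ≤ lam - 1
      | .D2 => lam - 1 - ‖x‖ ≤ ‖y‖ ∧ ‖y‖ ≤ lam - 1 + ‖x‖
      | .D3 => lam - 1 + ‖x‖ ≤ ‖y‖ ∧ ‖y‖ ^ 2 ≤ lam ^ 2 - 1 + ‖x‖ ^ 2
      | .D4 => lam ^ 2 - 1 + ‖x‖ ^ 2 ≤ ‖y‖ ^ 2)
  | .D0, hm => by
    have h := nonneg_of_eventually_nonneg (g := fun s : ℝ => 1 - (‖x + s • η‖ + ‖y + s • κ‖))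
      (by fun_prop) (by filter_upwards [hm] with s hs; simp only [Region.mem] at hs; linarith)
    simp only [zero_smul, add_zero] at h
    linarith
  | .D1, hm => by
    have h := nonneg_of_eventually_nonneg (g := fun s : ℝ => ‖x + s • η‖ + ‖y + s • κ‖ - 1)
      (by fun_prop) (by filter_upwards [hm] with s hs; simp only [Region.mem] at hs; linarith)
    have h' := nonneg_of_eventually_nonneg
      (g := fun s : ℝ => lam - 1 - (‖x + s • η‖ + ‖y + s • κ‖))
      (by fun_prop) (by filter_upwards [hm] with s hs; simp only [Region.mem] at hs; linarith)
    simp only [zero_smul, add_zero] at h h'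
    exact ⟨by linarith, by linarith⟩
  | .D2, hm => by
    have h := nonneg_of_eventually_nonneg
      (g := fun s : ℝ => ‖y + s • κ‖ - (lam - 1 - ‖x + s • η‖))
      (by fun_prop) (by filter_upwards [hm] with s hs; simp only [Region.mem] at hs; linarith)
    have h' := nonneg_of_eventually_nonneg
      (g := fun s : ℝ => lam - 1 + ‖x + s • η‖ - ‖y + s • κ‖)
      (by fun_prop) (by filter_upwards [hm] with s hs; simp only [Region.mem] at hs; linarith)
    simp only [zero_smul, add_zero] at h h'
    exact ⟨by linarith, by linarith⟩
  | .D3, hm => by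
    have h := nonneg_of_eventually_nonneg
      (g := fun s : ℝ => ‖y + s • κ‖ - (lam - 1 + ‖x + s • η‖))
      (by fun_prop) (by filter_upwards [hm] with s hs; simp only [Region.mem] at hs; linarith)
    have h' := nonneg_of_eventually_nonneg
      (g := fun s : ℝ => lam ^ 2 - 1 + ‖x + s • η‖ ^ 2 - ‖y + s • κ‖ ^ 2)
      (by fun_prop) (by filter_upwards [hm] with s hs; simp only [Region.mem] at hs; linarith)
    simp only [zero_smul, add_zero] at h h'
    exact ⟨by linarith, by linarith⟩
  | .D4, hm => by
    have h := nonneg_of_eventually_nonneg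
      (g := fun s : ℝ => ‖y + s • κ‖ ^ 2 - (lam ^ 2 - 1 + ‖x + s • η‖ ^ 2))
      (by fun_prop) (by filter_upwards [hm] with s hs; simp only [Region.mem] at hs; linarith)
    simp only [zero_smul, add_zero] at h
    linarith

/-- At the base point, `u` is given by the formula of the region visited just to the right.
[cite: Burkholder1991, §8 (continuity of `u`)] -/
theorem burkholderU_eq_piece_of_eventually_mem {lam : ℝ} (hlam : 2 < lam) {x y η κ : E}
    (hx : ‖x‖ < 1) {r : Region} (hm : ∀ᶠ s in 𝓝[>] (0:ℝ), r.mem lam ‖x + s • η‖ ‖y + s • κ‖) :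
    burkholderU lam x y = r.piece lam ‖x‖ ‖y‖ := by
  rw [burkholderU_eq_uR]
  have hcl := closure_of_eventually_mem hm
  cases r
  · exact uR_eq_piece_of_closure hlam (norm_nonneg _) hx (norm_nonneg _) .D0 hcl
  · exact uR_eq_piece_of_closure hlam (norm_nonneg _) hx (norm_nonneg _) .D1 hcl
  · exact uR_eq_piece_of_closure hlam (norm_nonneg _) hx (norm_nonneg _) .D2 hcl
  · exact uR_eq_piece_of_closure hlam (norm_nonneg _) hx (norm_nonneg _) .D3 hcl
  · exact uR_eq_piece_of_closure hlam (norm_nonneg _) hx (norm_nonneg _) .D4 hcl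

/-! ## The kinks: one-sided slopes across `∂D₂ ∩ ∂D₃` and `∂D₃ ∩ ∂D₄` ((8.16)) -/

/-- **(8.16) `G'(t₀-) ≥ G'(t₀+)`.** If just to the right of the base point the line is in `D_i`
and just to the left (direction `(-h, -k)`) it is in `D_j`, then `slope_i ≤ slope_j` at the base
point (`|x| < 1`, `|k| < |h|`, `λ > 2`). Across `∂D₀∩∂D₁` and `∂D₁∩∂D₂` (and at `x = 0`) the slopes
agree; across `∂D₂∩∂D₃` and `∂D₃∩∂D₄` the jump has the sign of the direction of crossing
(cases (i), (ii) of the printed proof). [cite: Burkholder1991, §8, (8.16)] -/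
theorem slope_right_le_slope_left {lam : ℝ} (hlam : 2 < lam) {x y h k : E} (hx : ‖x‖ < 1)
    {r r' : Region}
    (hr : ∀ᶠ s in 𝓝[>] (0:ℝ), r.mem lam ‖x + s • h‖ ‖y + s • k‖)
    (hr' : ∀ᶠ s in 𝓝[>] (0:ℝ), r'.mem lam ‖x + s • (-h)‖ ‖y + s • (-k)‖) :
    r.slope lam ‖x‖ ‖y‖ ⟪x, h⟫_ℝ ⟪y, k⟫_ℝ ≤ r'.slope lam ‖x‖ ‖y‖ ⟪x, h⟫_ℝ ⟪y, k⟫_ℝ := by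
  have hl1 : (1:ℝ) < lam := by linarith
  have ha0 := norm_nonneg x
  have hb0 := norm_nonneg y
  have hcl := closure_of_eventually_mem hr
  have hcl' := closure_of_eventually_mem hr'
  have hsq := sq_boundary_lt hl1 hx
  -- `x = 0 ⇒ x·h = 0`
  have hxh0 : ‖x‖ = 0 → ⟪x, h⟫_ℝ = 0 := fun h0 => by
    rw [norm_eq_zero.1 h0, inner_zero_left]
  -- derivative facts at the base point for the two kink curves
  have he4d : HasDerivAt (fun σ : ℝ => ‖y + σ • k‖ ^ 2 - ‖x + σ • h‖ ^ 2 - (lam ^ 2 - 1))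
      (2 * ⟪y, k⟫_ℝ - 2 * ⟪x, h⟫_ℝ) 0 := by
    have := ((hasDerivAt_norm_sq_line y k 0).fun_sub (hasDerivAt_norm_sq_line x h 0)).sub_const
      (lam ^ 2 - 1)
    simpa using this
  have he3d : ‖x‖ ≠ 0 → ‖y‖ ≠ 0 →
      HasDerivAt (fun σ : ℝ => ‖y + σ • k‖ - ‖x + σ • h‖ - (lam - 1))
        (⟪y, k⟫_ℝ / ‖y‖ - ⟪x, h⟫_ℝ / ‖x‖) 0 := fun hx0 hy0 => by
    have hA := hasDerivAt_norm_line x h 0 (by simpa using norm_ne_zero_iff.1 hx0)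
    have hB := hasDerivAt_norm_line y k 0 (by simpa using norm_ne_zero_iff.1 hy0)
    have := (hB.fun_sub hA).sub_const (lam - 1)
    simpa using this
  match r, r', hr, hr', hcl, hcl' with
  | .D0, .D0, _, _, _, _ => exact le_rfl
  | .D1, .D1, _, _, _, _ => exact le_rfl
  | .D2, .D2, _, _, _, _ => exact le_rfl
  | .D3, .D3, _, _, _, _ => exact le_rfl
  | .D4, .D4, _, _, _, _ => exact le_rfl
  | .D0, .D1, _, _, hcl, hcl' =>
    dsimp only at hcl hcl'
    have hab : ‖x‖ + ‖y‖ = 1 := le_antisymm hcl hcl'.1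
    exact (slope_D0_eq_D1 (by intro hb; linarith [hb]) hab).le
  | .D1, .D0, _, _, hcl, hcl' =>
    dsimp only at hcl hcl'
    have hab : ‖x‖ + ‖y‖ = 1 := le_antisymm hcl' hcl.1
    exact (slope_D0_eq_D1 (by intro hb; linarith [hb]) hab).ge
  | .D1, .D2, _, _, hcl, hcl' =>
    dsimp only at hcl hcl'
    have hab : ‖x‖ + ‖y‖ = lam - 1 := le_antisymm hcl.2 (by linarith [hcl'.1])
    exact (slope_D1_eq_D2 (by intro hb; linarith [hb]) ha0 hab).le
  | .D2, .D1, _, _, hcl, hcl' =>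
    dsimp only at hcl hcl'
    have hab : ‖x‖ + ‖y‖ = lam - 1 := le_antisymm hcl'.2 (by linarith [hcl.1])
    exact (slope_D1_eq_D2 (by intro hb; linarith [hb]) ha0 hab).ge
  | .D1, .D3, _, _, hcl, hcl' =>
    dsimp only at hcl hcl'
    have ha : ‖x‖ = 0 := by linarith [hcl.2, hcl'.1]
    have hb : ‖y‖ = lam - 1 := by linarith [hcl.2, hcl'.1]
    have := (slope_corner (xh := ⟪x, h⟫_ℝ) (yk := ⟪y, k⟫_ℝ) hl1 (hxh0 ha) hb).1
    rw [ha]; exact this.le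
  | .D3, .D1, _, _, hcl, hcl' =>
    dsimp only at hcl hcl'
    have ha : ‖x‖ = 0 := by linarith [hcl'.2, hcl.1]
    have hb : ‖y‖ = lam - 1 := by linarith [hcl'.2, hcl.1]
    have := (slope_corner (xh := ⟪x, h⟫_ℝ) (yk := ⟪y, k⟫_ℝ) hl1 (hxh0 ha) hb).1
    rw [ha]; exact this.ge
  | .D0, .D2, _, _, hcl, hcl' => dsimp only at hcl hcl'; exfalso; linarith [hcl, hcl'.1]
  | .D2, .D0, _, _, hcl, hcl' => dsimp only at hcl hcl'; exfalso; linarith [hcl', hcl.1]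
  | .D0, .D3, _, _, hcl, hcl' => dsimp only at hcl hcl'; exfalso; linarith [hcl, hcl'.1]
  | .D3, .D0, _, _, hcl, hcl' => dsimp only at hcl hcl'; exfalso; linarith [hcl', hcl.1]
  | .D0, .D4, _, _, hcl, hcl' =>
    dsimp only at hcl hcl'
    exfalso
    have hb1 : ‖y‖ ^ 2 ≤ 1 ^ 2 := pow_le_pow_left₀ hb0 (by linarith [hcl]) 2
    nlinarith [hcl']
  | .D4, .D0, _, _, hcl, hcl' =>
    dsimp only at hcl hcl'
    exfalso
    have hb1 : ‖y‖ ^ 2 ≤ 1 ^ 2 := pow_le_pow_left₀ hb0 (by linarith [hcl']) 2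
    nlinarith [hcl]
  | .D1, .D4, _, _, hcl, hcl' =>
    dsimp only at hcl hcl'
    exfalso
    have hb1 : ‖y‖ ^ 2 ≤ (lam - 1 + ‖x‖) ^ 2 := pow_le_pow_left₀ hb0 (by linarith [hcl.2]) 2
    linarith [hcl']
  | .D4, .D1, _, _, hcl, hcl' =>
    dsimp only at hcl hcl'
    exfalso
    have hb1 : ‖y‖ ^ 2 ≤ (lam - 1 + ‖x‖) ^ 2 := pow_le_pow_left₀ hb0 (by linarith [hcl'.2]) 2
    linarith [hcl]
  | .D2, .D4, _, _, hcl, hcl' =>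
    dsimp only at hcl hcl'
    exfalso
    have hb1 : ‖y‖ ^ 2 ≤ (lam - 1 + ‖x‖) ^ 2 := pow_le_pow_left₀ hb0 hcl.2 2
    linarith [hcl']
  | .D4, .D2, _, _, hcl, hcl' =>
    dsimp only at hcl hcl'
    exfalso
    have hb1 : ‖y‖ ^ 2 ≤ (lam - 1 + ‖x‖) ^ 2 := pow_le_pow_left₀ hb0 hcl'.2 2
    linarith [hcl]
  | .D2, .D3, hr, _, hcl, hcl' =>
    -- crossing from `D₃` (left) into `D₂` (right): `e₃'(0) ≤ 0`
    dsimp only at hcl hcl'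
    have hb : ‖y‖ = lam - 1 + ‖x‖ := le_antisymm hcl.2 hcl'.1
    rcases ha0.eq_or_lt with ha | ha
    · have := (slope_corner (b := ‖y‖) (xh := ⟪x, h⟫_ℝ) (yk := ⟪y, k⟫_ℝ) hl1 (hxh0 ha.symm)
        (by rw [hb, ← ha]; ring)).2
      rw [← ha]; exact this.le
    · have hy : ‖y‖ ≠ 0 := by rw [hb]; exact (by linarith : 0 < lam - 1 + ‖x‖).ne'
      have hd := deriv_nonpos_of_eventually_nonpos (he3d ha.ne' hy) (by simp [hb])
        (by filter_upwards [hr] with s hs; simp only [Region.mem] at hs; linarith)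
      have key := slope_D2_sub_D3 (xh := ⟪x, h⟫_ℝ) (yk := ⟪y, k⟫_ℝ) hl1 ha.ne' hy hx hb
      have hc : 0 ≤ ‖x‖ * (lam - 2) / (2 * (lam - 1)) :=
        div_nonneg (mul_nonneg ha0 (by linarith)) (by linarith)
      have := mul_nonpos_of_nonneg_of_nonpos hc hd
      linarith
  | .D3, .D2, hr, _, hcl, hcl' =>
    -- crossing from `D₂` (left) into `D₃` (right): `e₃'(0) ≥ 0`
    dsimp only at hcl hcl'
    have hb : ‖y‖ = lam - 1 + ‖x‖ := le_antisymm hcl'.2 hcl.1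
    rcases ha0.eq_or_lt with ha | ha
    · have := (slope_corner (b := ‖y‖) (xh := ⟪x, h⟫_ℝ) (yk := ⟪y, k⟫_ℝ) hl1 (hxh0 ha.symm)
        (by rw [hb, ← ha]; ring)).2
      rw [← ha]; exact this.ge
    · have hy : ‖y‖ ≠ 0 := by rw [hb]; exact (by linarith : 0 < lam - 1 + ‖x‖).ne'
      have hd := deriv_nonneg_of_eventually_nonneg (he3d ha.ne' hy) (by simp [hb])
        (by filter_upwards [hr] with s hs; simp only [Region.mem] at hs; linarith)
      have key := slope_D2_sub_D3 (xh := ⟪x, h⟫_ℝ) (yk := ⟪y, k⟫_ℝ) hl1 ha.ne' hy hx hb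
      have hc : 0 ≤ ‖x‖ * (lam - 2) / (2 * (lam - 1)) :=
        div_nonneg (mul_nonneg ha0 (by linarith)) (by linarith)
      have := mul_nonneg hc hd
      linarith
  | .D3, .D4, hr, _, hcl, hcl' =>
    dsimp only at hcl hcl'
    have hb : ‖y‖ ^ 2 = lam ^ 2 - 1 + ‖x‖ ^ 2 := le_antisymm hcl.2 hcl'
    have hd := deriv_nonpos_of_eventually_nonpos he4d (by simp [hb])
      (by filter_upwards [hr] with s hs; simp only [Region.mem] at hs; linarith)
    rw [slope_D3_eq hl1]
    simp only [Region.slope]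
    exact div_nonpos_of_nonpos_of_nonneg (by linarith) (by linarith)
  | .D4, .D3, hr, _, hcl, hcl' =>
    dsimp only at hcl hcl'
    have hb : ‖y‖ ^ 2 = lam ^ 2 - 1 + ‖x‖ ^ 2 := le_antisymm hcl'.2 hcl
    have hd := deriv_nonneg_of_eventually_nonneg he4d (by simp [hb])
      (by filter_upwards [hr] with s hs; simp only [Region.mem] at hs; linarith)
    rw [slope_D3_eq hl1]
    simp only [Region.slope]
    exact div_nonneg (by linarith) (by linarith)

end Regions


/-! ## One-sided tangents along the line: `G(t) ≤ G(0) + G'(0+)t` on `[0, δ)` ((8.14)–(8.15)) -/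

section Tangent

variable {E : Type*} [NormedAddCommGroup E] [InnerProductSpace ℝ E]

/-- On an interval `[0, δ)` on which the line stays in ONE region `D_i` (for `t > 0`), the
`i`-th formula along the line is continuous and lies below its one-sided tangent at `0`:
`f_i(t) ≤ f_i(0) + [φ·h + ψ·k](0) t` — from (8.14) (`G' = φ·h + ψ·k`), (8.15) (`G'' ≤ 0`) and the
continuity of the formula up to `t = 0`. [cite: Burkholder1991, §8, (8.14)–(8.15)] -/
theorem piece_le_tangent {lam : ℝ} (hlam : 2 < lam) {x y h k : E} (hx : ‖x‖ < 1)
    (hhk : ‖k‖ ≤ ‖h‖) {δ : ℝ} (hδ : 0 < δ) {r : Region}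
    (hm : ∀ s ∈ Ioo (0:ℝ) δ, r.mem lam ‖x + s • h‖ ‖y + s • k‖) :
    ContinuousOn (fun σ : ℝ => r.piece lam ‖x + σ • h‖ ‖y + σ • k‖) (Ico 0 δ) ∧
    ∀ s ∈ Ico (0:ℝ) δ, r.piece lam ‖x + s • h‖ ‖y + s • k‖
      ≤ r.piece lam ‖x‖ ‖y‖ + r.slope lam ‖x‖ ‖y‖ ⟪x, h⟫_ℝ ⟪y, k⟫_ℝ * s := by
  have hl1 : (1:ℝ) < lam := by linarith
  -- the scalar curves and their derivatives
  have hA2 : ∀ s : ℝ, HasDerivAt (fun σ : ℝ => ‖x + σ • h‖ ^ 2) (2 * ⟪x + s • h, h⟫_ℝ) s :=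
    fun s => hasDerivAt_norm_sq_line x h s
  have hB2 : ∀ s : ℝ, HasDerivAt (fun σ : ℝ => ‖y + σ • k‖ ^ 2) (2 * ⟪y + s • k, k⟫_ℝ) s :=
    fun s => hasDerivAt_norm_sq_line y k s
  have hA1 : ∀ s : ℝ, ‖x + s • h‖ ≠ 0 →
      HasDerivAt (fun σ : ℝ => ‖x + σ • h‖) (⟪x + s • h, h⟫_ℝ / ‖x + s • h‖) s :=
    fun s hs => hasDerivAt_norm_line x h s (norm_ne_zero_iff.1 hs)
  have hB1 : ∀ s : ℝ, ‖y + s • k‖ ≠ 0 →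
      HasDerivAt (fun σ : ℝ => ‖y + σ • k‖) (⟪y + s • k, k⟫_ℝ / ‖y + s • k‖) s :=
    fun s hs => hasDerivAt_norm_line y k s (norm_ne_zero_iff.1 hs)
  have hXH : ∀ s : ℝ, HasDerivAt (fun σ : ℝ => ⟪x + σ • h, h⟫_ℝ) (‖h‖ ^ 2) s :=
    fun s => hasDerivAt_inner_line x h s
  have hYK : ∀ s : ℝ, HasDerivAt (fun σ : ℝ => ⟪y + σ • k, k⟫_ℝ) (‖k‖ ^ 2) s :=
    fun s => hasDerivAt_inner_line y k s
  have hcs : ∀ s : ℝ, ⟪y + s • k, k⟫_ℝ ^ 2 ≤ ‖y + s • k‖ ^ 2 * ‖k‖ ^ 2 :=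
    fun s => inner_sq_le _ _
  have hk2 : ‖k‖ ^ 2 ≤ ‖h‖ ^ 2 := pow_le_pow_left₀ (norm_nonneg _) hhk 2
  -- names for the four scalar curves
  set A : ℝ → ℝ := fun σ => ‖x + σ • h‖ with hAdef
  set B : ℝ → ℝ := fun σ => ‖y + σ • k‖ with hBdef
  set XH : ℝ → ℝ := fun σ => ⟪x + σ • h, h⟫_ℝ with hXHdef
  set YK : ℝ → ℝ := fun σ => ⟪y + σ • k, k⟫_ℝ with hYKdef
  -- `|x + σh| < 1` on `[0, δ)`
  have hA1lt : ∀ σ ∈ Ico (0:ℝ) δ, ‖x + σ • h‖ < 1 := by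
    intro σ hσ
    rcases hσ.1.eq_or_lt with h0 | h0
    · rw [← h0]; simpa using hx
    · exact lt_one_of_mem (hm σ ⟨h0, hσ.2⟩)
  -- the curvature sign along `(0, δ)`
  have hχ : ∀ s ∈ Ioo (0:ℝ) δ,
      r.curv lam (A s) (B s) (XH s) (YK s) (‖h‖ ^ 2) (‖k‖ ^ 2) ≤ 0 :=
    fun s hs => curv_nonpos hlam (norm_nonneg _) hk2 (hcs s) (hm s hs)
  -- conclude, region by region
  have main : ContinuousOn (fun σ : ℝ => r.piece lam (A σ) (B σ)) (Ico 0 δ) ∧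
      ContinuousOn (fun σ : ℝ => r.slope lam (A σ) (B σ) (XH σ) (YK σ)) (Ico 0 δ) ∧
      (∀ s ∈ Ioo (0:ℝ) δ, HasDerivAt (fun σ : ℝ => r.piece lam (A σ) (B σ))
        (r.slope lam (A s) (B s) (XH s) (YK s)) s) ∧
      (∀ s ∈ Ioo (0:ℝ) δ, HasDerivAt (fun σ : ℝ => r.slope lam (A σ) (B σ) (XH σ) (YK σ))
        (r.curv lam (A s) (B s) (XH s) (YK s) (‖h‖ ^ 2) (‖k‖ ^ 2)) s) := by
    cases r
    · -- D0
      refine ⟨?_, ?_, fun s _ => hasDerivAt_piece_D0 (A := A) (B := B) (XH := XH) (YK := YK)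
          (hA2 s) (hB2 s),
        fun s _ => hasDerivAt_slope_D0 (A := A) (B := B) (XH := XH) (YK := YK) (hXH s) (hYK s)⟩
      · simp only [Region.piece, f0, hAdef, hBdef]
        exact Continuous.continuousOn (by fun_prop)
      · simp only [Region.slope, hXHdef, hYKdef]
        exact Continuous.continuousOn (by fun_prop)
    · -- D1
      have hcl := closure_of_eventually_mem (eventually_of_Ioo hδ hm)
      dsimp only at hcl
      have hBpos : ∀ σ ∈ Ico (0:ℝ) δ, ‖y + σ • k‖ ≠ 0 := by
        intro σ hσ
        rcases hσ.1.eq_or_lt with h0 | h0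
        · rw [← h0]; simp only [zero_smul, add_zero]
          exact (by linarith [hcl.1] : 0 < ‖y‖).ne'
        · exact (pos_b_of_mem_D1 (hm σ ⟨h0, hσ.2⟩)).ne'
      have hApos : ∀ σ ∈ Ioo (0:ℝ) δ, ‖x + σ • h‖ ≠ 0 := fun σ hσ => by
        have := hm σ hσ; simp only [Region.mem] at this; exact this.2.2.1.ne'
      refine ⟨?_, ?_, fun s hs => hasDerivAt_piece_D1 (A := A) (B := B) (XH := XH) (YK := YK)
          (hA1 s (hApos s hs)) (hB1 s (hBpos s (Ioo_subset_Ico_self hs))) (hApos s hs)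
          (hBpos s (Ioo_subset_Ico_self hs)),
        fun s hs => hasDerivAt_slope_D1 (A := A) (B := B) (XH := XH) (YK := YK)
          (hA1 s (hApos s hs)) (hB1 s (hBpos s (Ioo_subset_Ico_self hs))) (hXH s) (hYK s)
          (hApos s hs) (hBpos s (Ioo_subset_Ico_self hs))⟩
      · simp only [Region.piece, f1, hAdef, hBdef]
        exact Continuous.continuousOn (by fun_prop)
      · simp only [Region.slope, hAdef, hBdef, hXHdef, hYKdef]
        intro σ hσ
        have hB := hBpos σ hσ
        apply ContinuousAt.continuousWithinAt
        apply ContinuousAt.mul (by fun_prop)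
        apply ContinuousAt.add (by fun_prop)
        exact ContinuousAt.div (by fun_prop) (by fun_prop) hB
    · -- D2
      have hcl := closure_of_eventually_mem (eventually_of_Ioo hδ hm)
      dsimp only at hcl
      have hBpos : ∀ σ ∈ Ico (0:ℝ) δ, ‖y + σ • k‖ ≠ 0 := by
        intro σ hσ
        rcases hσ.1.eq_or_lt with h0 | h0
        · rw [← h0]; simp only [zero_smul, add_zero]
          exact (by linarith [hcl.1] : 0 < ‖y‖).ne'
        · exact (pos_b_of_mem_D2 hlam (hm σ ⟨h0, hσ.2⟩)).ne'
      have hden : ∀ σ ∈ Ico (0:ℝ) δ, (lam - ‖y + σ • k‖) ^ 2 + 1 - ‖x + σ • h‖ ^ 2 ≠ 0 :=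
        fun σ hσ => (den_pos_of_lt_one (norm_nonneg _) (hA1lt σ hσ)).ne'
      refine ⟨?_, ?_, fun s hs => hasDerivAt_piece_D2 (A := A) (B := B) (XH := XH) (YK := YK)
          (hA2 s) (hB1 s (hBpos s (Ioo_subset_Ico_self hs))) (hBpos s (Ioo_subset_Ico_self hs))
          (hden s (Ioo_subset_Ico_self hs)),
        fun s hs => hasDerivAt_slope_D2 (A := A) (B := B) (XH := XH) (YK := YK) (hA2 s)
          (hB1 s (hBpos s (Ioo_subset_Ico_self hs))) (hXH s) (hYK s)
          (hBpos s (Ioo_subset_Ico_self hs)) (hden s (Ioo_subset_Ico_self hs))⟩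
      · simp only [Region.piece, f2, hAdef, hBdef]
        intro σ hσ
        have hD := hden σ hσ
        apply ContinuousAt.continuousWithinAt
        exact ContinuousAt.div (by fun_prop) (by fun_prop) hD
      · simp only [Region.slope, hAdef, hBdef, hXHdef, hYKdef]
        intro σ hσ
        have hB := hBpos σ hσ
        have hD : ((lam - ‖y + σ • k‖) ^ 2 + 1 - ‖x + σ • h‖ ^ 2) ^ 2 ≠ 0 :=
          pow_ne_zero 2 (hden σ hσ)
        apply ContinuousAt.continuousWithinAt
        refine ContinuousAt.div ?_ (by fun_prop) hD
        apply ContinuousAt.add (by fun_prop)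
        exact ContinuousAt.div (by fun_prop) (by fun_prop) hB
    · -- D3
      refine ⟨?_, ?_, fun s _ => hasDerivAt_piece_D3 (A := A) (B := B) (XH := XH) (YK := YK) hl1
          (hA2 s) (hB2 s),
        fun s _ => hasDerivAt_slope_D3 (A := A) (B := B) (XH := XH) (YK := YK) (hXH s) (hYK s)⟩
      · simp only [Region.piece, f3, hAdef, hBdef]
        exact Continuous.continuousOn (by fun_prop)
      · simp only [Region.slope, hXHdef, hYKdef]
        exact Continuous.continuousOn (by fun_prop)
    · -- D4
      refine ⟨?_, ?_, fun s _ => hasDerivAt_piece_D4 (A := A) (B := B) (XH := XH) (YK := YK),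
        fun s _ => hasDerivAt_slope_D4 (A := A) (B := B) (XH := XH) (YK := YK)⟩
      · simp only [Region.piece]; exact continuousOn_const
      · simp only [Region.slope]; exact continuousOn_const
  obtain ⟨hΦc, hψc, hd1, hd2⟩ := main
  refine ⟨hΦc, ?_⟩
  have key := le_tangent_of_deriv2_nonpos hδ hΦc hψc hd1 hd2 hχ
  intro s hs
  have := key s hs
  simp only [hAdef, hBdef, hXHdef, hYKdef, zero_smul, add_zero] at this
  exact this

/-- Values along `[0, δ)`: `u = f_i` on the line (at `t = 0` by the continuity of `u` inside `S`).
[cite: Burkholder1991, §8 (continuity of `u`)] -/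
theorem burkholderU_eq_piece_on_Ico {lam : ℝ} (hlam : 2 < lam) {x y h k : E} (hx : ‖x‖ < 1)
    {δ : ℝ} (hδ : 0 < δ) {r : Region} (hm : ∀ s ∈ Ioo (0:ℝ) δ, r.mem lam ‖x + s • h‖ ‖y + s • k‖) :
    ∀ s ∈ Ico (0:ℝ) δ, burkholderU lam (x + s • h) (y + s • k) = r.piece lam ‖x + s • h‖ ‖y + s • k‖ := by
  intro s hs
  rcases hs.1.eq_or_lt with h0 | h0
  · rw [← h0]
    simpa using burkholderU_eq_piece_of_eventually_mem hlam hx (eventually_of_Ioo hδ hm)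
  · rw [burkholderU_eq_uR]
    exact uR_eq_piece hlam (norm_nonneg _) (norm_nonneg _) (hm s ⟨h0, hs.2⟩)

/-- **Right-hand structure at an interior point.** For `|x| < 1`, `|k| < |h|`, `λ > 2`: the
region `D_i` visited just to the right, right-continuity of `t ↦ u(x + th, y + tk)` at `0`, and
the one-sided tangent bound `u(x + th, y + tk) ≤ u(x, y) + G'(0+) t` for small `t > 0`, with
`G'(0+) = [φ_i·h + ψ_i·k](x, y)`. [cite: Burkholder1991, §8, (8.14)–(8.15)] -/
theorem right_structure {lam : ℝ} (hlam : 2 < lam) {x y h k : E} (hx : ‖x‖ < 1)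
    (hhk : ‖k‖ < ‖h‖) :
    ∃ r : Region, ∃ δ > (0:ℝ),
      (∀ᶠ s in 𝓝[>] (0:ℝ), r.mem lam ‖x + s • h‖ ‖y + s • k‖) ∧
      ContinuousWithinAt (fun s : ℝ => burkholderU lam (x + s • h) (y + s • k)) (Ici 0) 0 ∧
      ∀ s ∈ Ioo (0:ℝ) δ, burkholderU lam (x + s • h) (y + s • k)
        ≤ burkholderU lam x y + r.slope lam ‖x‖ ‖y‖ ⟪x, h⟫_ℝ ⟪y, k⟫_ℝ * s := by
  obtain ⟨r, hr⟩ := eventually_mem_region lam (y := y) hx hhk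
  obtain ⟨δ, hδ, hm⟩ := exists_Ioo_of_eventually hr
  obtain ⟨hΦc, htan⟩ := piece_le_tangent hlam hx hhk.le hδ hm (y := y)
  have hval := burkholderU_eq_piece_on_Ico hlam hx hδ hm (y := y)
  have h0 : (0:ℝ) ∈ Ico 0 δ := left_mem_Ico.2 hδ
  refine ⟨r, δ, hδ, hr, ?_, ?_⟩
  · have hc : ContinuousWithinAt (fun σ : ℝ => r.piece lam ‖x + σ • h‖ ‖y + σ • k‖) (Ici 0) 0 :=
      (hΦc 0 h0).mono_of_mem_nhdsWithin (Ico_mem_nhdsGE hδ)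
    refine hc.congr_of_eventuallyEq ?_ (hval 0 h0)
    filter_upwards [Ico_mem_nhdsGE hδ] with s hs using hval s hs
  · intro s hs
    have h1 := htan s (Ioo_subset_Ico_self hs)
    have h2 := hval s (Ioo_subset_Ico_self hs)
    have h3 := hval 0 h0
    simp only [zero_smul, add_zero] at h3
    rw [h2, h3]
    exact h1

/-! ## Local midpoint concavity at interior points, and continuity there -/

/-- **`G(t-s) + G(t+s) ≤ 2G(t)` for small `s > 0`** at every interior point (`|x| < 1`) of a
line with `|k| < |h|`: the two one-sided tangent bounds and the kink inequality (8.16).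
[cite: Burkholder1991, §8, proof of (8.10) ("The function `G` is concave on `I`")] -/
theorem midpoint_sum_le {lam : ℝ} (hlam : 2 < lam) {x y h k : E} (hx : ‖x‖ < 1)
    (hhk : ‖k‖ < ‖h‖) :
    ∀ᶠ s in 𝓝[>] (0:ℝ), burkholderU lam (x + s • (-h)) (y + s • (-k))
      + burkholderU lam (x + s • h) (y + s • k) ≤ 2 * burkholderU lam x y := by
  obtain ⟨r, δ, hδ, hr, -, ht⟩ := right_structure hlam hx hhk (y := y)
  have hhk' : ‖-k‖ < ‖-h‖ := by simpa using hhk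
  obtain ⟨r', δ', hδ', hr', -, ht'⟩ := right_structure hlam hx hhk' (y := y)
  have hkink := slope_right_le_slope_left hlam hx hr hr' (k := k)
  filter_upwards [Ioo_mem_nhdsGT (lt_min hδ hδ')] with s hs
  have h1 := ht s ⟨hs.1, lt_of_lt_of_le hs.2 (min_le_left _ _)⟩
  have h2 := ht' s ⟨hs.1, lt_of_lt_of_le hs.2 (min_le_right _ _)⟩
  rw [inner_neg_right, inner_neg_right, slope_neg] at h2
  have h3 := mul_le_mul_of_nonneg_right hkink hs.1.le
  linarith

/-- Continuity of `t ↦ u(x + th, y + tk)` at every `t` with `|x + th| < 1` (`|k| < |h|`): the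
restriction of `u` to the interior of `S` is continuous along such lines.
[cite: Burkholder1991, §8 ("the restriction of `u` to the interior of `S` is continuous")] -/
theorem continuousAt_line {lam : ℝ} (hlam : 2 < lam) {x y h k : E} (hhk : ‖k‖ < ‖h‖) {t : ℝ}
    (ht : ‖x + t • h‖ < 1) :
    ContinuousAt (fun t' : ℝ => burkholderU lam (x + t' • h) (y + t' • k)) t := by
  have hhk' : ‖-k‖ < ‖-h‖ := by simpa using hhk
  obtain ⟨-, -, -, -, hcr, -⟩ := right_structure hlam ht hhk (y := y + t • k)
  obtain ⟨-, -, -, -, hcl, -⟩ := right_structure hlam ht hhk' (y := y + t • k)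
  -- continuity at `0` of `F(s) = u(x_t + sh, y_t + sk)`
  have hF : ContinuousAt (fun s : ℝ => burkholderU lam (x + t • h + s • h) (y + t • k + s • k)) 0 := by
    rw [continuousAt_iff_continuous_left_right]
    constructor
    · -- left: `F(s) = F⁻(-s)`
      have hneg : Tendsto (fun s : ℝ => -s) (𝓝[Iic (0:ℝ)] 0) (𝓝[Ici (0:ℝ)] 0) := by
        have := (continuous_neg.continuousWithinAt (s := Iic (0:ℝ)) (x := 0)).tendsto_nhdsWithin
          (t := Ici (0:ℝ)) (fun s hs => by simp only [mem_Iic, mem_Ici] at hs ⊢; linarith)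
        simpa using this
      have hcomp := hcl.tendsto.comp hneg
      simp only [ContinuousWithinAt, zero_smul, add_zero] at hcomp ⊢
      refine hcomp.congr fun s => ?_
      simp only [Function.comp_apply, smul_neg, neg_smul, neg_neg]
    · exact hcr
  -- translate
  have hcomp := hF.comp_of_eq (continuous_sub_right t).continuousAt (sub_self t)
  refine hcomp.congr (Eventually.of_forall fun t' => ?_)
  simp only [Function.comp_apply]
  rw [show x + t • h + (t' - t) • h = x + t' • h by rw [sub_smul]; abel,
    show y + t • k + (t' - t) • k = y + t' • k by rw [sub_smul]; abel]

end Tangent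

/-! ## The endpoints of `I`: `|x + th| = 1` ((8.9)) -/

section Endpoint

variable {E : Type*} [NormedAddCommGroup E] [InnerProductSpace ℝ E]

omit [InnerProductSpace ℝ E] in
/-- `u = 1` whenever `|y|² > λ² - 1 + |x|²` (`λ > 0`): on `D₄` and at the boundary points above it
(including `|x| = 1`, `|y| > λ`). [cite: Burkholder1991, §8, display after (8.8)] -/
theorem burkholderU_eq_one_of_sq_lt {lam : ℝ} (hlam : 0 < lam) {x y : E}
    (h : lam ^ 2 - 1 + ‖x‖ ^ 2 < ‖y‖ ^ 2) : burkholderU lam x y = 1 := by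
  unfold burkholderU
  by_cases h1 : ‖x‖ = 1
  · rw [if_pos h1]
    rw [h1] at h
    have : lam ≤ ‖y‖ := by nlinarith [norm_nonneg y]
    rw [if_pos this]
  · rw [if_neg h1, if_pos h]

/-- **(8.9) at the corner `|x| = 1`, `|y| = λ`.** Along any line through such a point, inside
`S`, `u → 1 = u(x, y)`: for every `ε > 0` and all small `s > 0` with `|x + sη| ≤ 1`,
`u(x + sη, y + sκ) ≥ 1 - ε` (`η ≠ 0`; printed for rays: "`u(rx, ry) = (1+r)/(λ²(1-r)+1+r) ↑ 1`").
[cite: Burkholder1991, §8, (8.9)] -/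
theorem corner_le_eventually {lam : ℝ} (hlam : 2 < lam) {X Y η κ : E} (hX : ‖X‖ = 1)
    (hY : ‖Y‖ = lam) (hη : η ≠ 0) {ε : ℝ} (hε : 0 < ε) :
    ∀ᶠ s in 𝓝[>] (0:ℝ), ‖X + s • η‖ ≤ 1 → 1 - ε ≤ burkholderU lam (X + s • η) (Y + s • κ) := by
  have hηpos : 0 < ‖η‖ := norm_pos_iff.2 hη
  by_cases hc : 0 ≤ ⟪X, η⟫_ℝ
  · filter_upwards [self_mem_nhdsWithin] with s hs hle
    exfalso
    have hs0 : 0 < s := hs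
    have e := norm_add_smul_sq X η s
    rw [hX] at e
    have h1 : ‖X + s • η‖ ^ 2 ≤ 1 := by
      have := pow_le_pow_left₀ (norm_nonneg _) hle 2; simpa using this
    have h2 : 0 < s ^ 2 * ‖η‖ ^ 2 := by positivity
    linarith [mul_nonneg hs0.le hc]
  push Not at hc
  have hc' : 0 < -⟪X, η⟫_ℝ := by linarith
  obtain ⟨M, hM⟩ : ∃ M : ℝ, M = 2 * ‖Y‖ * ‖κ‖ + ‖κ‖ ^ 2 := ⟨_, rfl⟩
  have hM0 : 0 ≤ M := by rw [hM]; positivity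
  obtain ⟨N, hN⟩ : ∃ N : ℝ, N = 2 * (-⟪X, η⟫_ℝ) + 2 * ‖Y‖ * ‖κ‖ + ‖η‖ ^ 2 := ⟨_, rfl⟩
  have hN0 : 0 ≤ N := by rw [hN]; positivity
  have hl1 : 0 < lam - 1 := by linarith
  have hK2 : 0 < -⟪X, η⟫_ℝ / ‖η‖ ^ 2 := by positivity
  have hK3 : 0 < 4 * (lam - 1) * ε / (N + 1) := by positivity
  have hK4 : 0 < ε * (-⟪X, η⟫_ℝ) / (M ^ 2 + 1) := by positivity
  have hK5 : 0 < 1 / (M + 1) := by positivity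
  filter_upwards [Ioo_mem_nhdsGT (zero_lt_one : (0:ℝ) < 1), Ioo_mem_nhdsGT hK2,
    Ioo_mem_nhdsGT hK3, Ioo_mem_nhdsGT hK4, Ioo_mem_nhdsGT hK5] with s h1 h2 h3 h4 h5 hle
  have hs0 : 0 < s := h1.1
  have hs1 : s < 1 := h1.2
  -- consequences of the smallness conditions
  have hsη : s * ‖η‖ ^ 2 < -⟪X, η⟫_ℝ := by
    have := h2.2; rwa [lt_div_iff₀ (by positivity)] at this
  have hsN : s * N < 4 * (lam - 1) * ε := by
    have := h3.2; rw [lt_div_iff₀ (by positivity)] at this; linarith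
  have hsM2 : s * M ^ 2 < ε * (-⟪X, η⟫_ℝ) := by
    have := h4.2; rw [lt_div_iff₀ (by positivity)] at this; linarith
  have hsM : s * M < 1 := by
    have := h5.2; rw [lt_div_iff₀ (by positivity)] at this; linarith
  -- `P = |X + sη|²`, `Q = |Y + sκ|²`
  have hP : ‖X + s • η‖ ^ 2 = 1 + 2 * s * ⟪X, η⟫_ℝ + s ^ 2 * ‖η‖ ^ 2 := by
    rw [norm_add_smul_sq, hX]; ring
  have hQ : ‖Y + s • κ‖ ^ 2 = lam ^ 2 + 2 * s * ⟪Y, κ⟫_ℝ + s ^ 2 * ‖κ‖ ^ 2 := by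
    rw [norm_add_smul_sq, hY]
  have hyk : |⟪Y, κ⟫_ℝ| ≤ ‖Y‖ * ‖κ‖ := abs_real_inner_le_norm Y κ
  have hyk1 := le_abs_self ⟪Y, κ⟫_ℝ
  have hyk2 := neg_abs_le ⟪Y, κ⟫_ℝ
  have h1P : s * (-⟪X, η⟫_ℝ) ≤ 1 - ‖X + s • η‖ ^ 2 := by
    rw [hP]; linarith [mul_lt_mul_of_pos_left hsη hs0]
  have h1P' : 0 < 1 - ‖X + s • η‖ ^ 2 := lt_of_lt_of_le (by positivity) h1P
  have ha1 : ‖X + s • η‖ < 1 := by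
    have : ‖X + s • η‖ ^ 2 < 1 ^ 2 := by linarith
    exact lt_of_pow_lt_pow_left₀ 2 zero_le_one this
  -- `|λ² - Q| ≤ sM` and `|λ - b| ≤ sM`
  have hs2 : s ^ 2 ≤ s := by nlinarith
  have e1 : s ^ 2 * ‖κ‖ ^ 2 ≤ s * ‖κ‖ ^ 2 := mul_le_mul_of_nonneg_right hs2 (sq_nonneg _)
  have e1' : s ^ 2 * ‖η‖ ^ 2 ≤ s * ‖η‖ ^ 2 := mul_le_mul_of_nonneg_right hs2 (sq_nonneg _)
  have hκ2 : 0 ≤ s ^ 2 * ‖κ‖ ^ 2 := by positivity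
  have h2s : 2 * s * ⟪Y, κ⟫_ℝ ≤ 2 * s * (‖Y‖ * ‖κ‖) :=
    mul_le_mul_of_nonneg_left (hyk1.trans hyk) (by positivity)
  have h2s' : 2 * s * (-(‖Y‖ * ‖κ‖)) ≤ 2 * s * ⟪Y, κ⟫_ℝ :=
    mul_le_mul_of_nonneg_left (by linarith) (by positivity)
  have hsc : 2 * s * ⟪X, η⟫_ℝ ≤ 0 := by have := mul_neg_of_pos_of_neg hs0 hc; linarith
  have hlamQ : |lam ^ 2 - ‖Y + s • κ‖ ^ 2| ≤ s * M := by
    rw [hQ, hM, abs_le]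
    constructor
    · linarith
    · linarith
  have hlb : |lam - ‖Y + s • κ‖| ≤ s * M := by
    have hsum : 1 ≤ lam + ‖Y + s • κ‖ := by linarith [norm_nonneg (Y + s • κ)]
    have hprod : |lam - ‖Y + s • κ‖| * (lam + ‖Y + s • κ‖) = |lam ^ 2 - ‖Y + s • κ‖ ^ 2| := by
      rw [← abs_of_pos (by linarith : 0 < lam + ‖Y + s • κ‖), ← abs_mul]
      congr 1; ring
    calc |lam - ‖Y + s • κ‖| ≤ |lam - ‖Y + s • κ‖| * (lam + ‖Y + s • κ‖) :=
          le_mul_of_one_le_right (abs_nonneg _) hsum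
      _ = |lam ^ 2 - ‖Y + s • κ‖ ^ 2| := hprod
      _ ≤ s * M := hlamQ
  have hLb : (lam - ‖Y + s • κ‖) ^ 2 ≤ ε * (1 - ‖X + s • η‖ ^ 2) := by
    have e1 : (lam - ‖Y + s • κ‖) ^ 2 ≤ (s * M) ^ 2 := by
      rw [← sq_abs (lam - _)]; exact pow_le_pow_left₀ (abs_nonneg _) hlb 2
    have e2 : (s * M) ^ 2 = s * (s * M ^ 2) := by ring
    have e3 : s * (s * M ^ 2) ≤ s * (ε * (-⟪X, η⟫_ℝ)) := mul_le_mul_of_nonneg_left hsM2.le hs0.le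
    have e4 : ε * (s * (-⟪X, η⟫_ℝ)) ≤ ε * (1 - ‖X + s • η‖ ^ 2) :=
      mul_le_mul_of_nonneg_left h1P hε.le
    linarith
  -- the value of `u`
  rw [burkholderU_eq_uR]
  unfold uR
  rw [if_neg ha1.ne]
  split_ifs with i1 i2 i3 i4
  · linarith
  · -- `D₃` formula: `0 ≤ λ² - 1 - Q + P ≤ sN < 4(λ-1)ε`
    simp only [f3]
    have hnum : lam ^ 2 - 1 - ‖Y + s • κ‖ ^ 2 + ‖X + s • η‖ ^ 2 ≤ s * N := by
      rw [hP, hQ, hN]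
      linarith
    have hfrac : (lam ^ 2 - 1 - ‖Y + s • κ‖ ^ 2 + ‖X + s • η‖ ^ 2) / (4 * (lam - 1)) ≤ ε := by
      rw [div_le_iff₀ (by positivity)]
      linarith
    linarith
  · -- `D₂` formula: `(λ - b)² ≤ ε(1 - P)`
    simp only [f2]
    have hsq := sq_nonneg (lam - ‖Y + s • κ‖)
    have hD : 0 < (lam - ‖Y + s • κ‖) ^ 2 + 1 - ‖X + s • η‖ ^ 2 := by linarith
    rw [le_div_iff₀ hD]
    have hεL := mul_nonneg hε.le hsq
    linarith
  · exfalso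
    -- `b ≥ λ - sM > λ - 1 ≥ λ - 1 - a`
    have : lam - ‖Y + s • κ‖ ≤ s * M := (le_abs_self _).trans hlb
    linarith [norm_nonneg (X + s • η)]
  · exfalso
    have : lam - ‖Y + s • κ‖ ≤ s * M := (le_abs_self _).trans hlb
    linarith [norm_nonneg (X + s • η)]

end Endpoint


/-! ## Concavity of `G(t) = u(x + th, y + tk)` on `I = {t : |x + th| ≤ 1}` -/

section Main

variable {E : Type*} [NormedAddCommGroup E] [InnerProductSpace ℝ E]

/-- Strict convexity of `t ↦ |x + th|²` (`h ≠ 0`): strictly between two points of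
`I = {|x + th| ≤ 1}` one has `|x + th| < 1` ("`|x + ht| < 1` if `t` is in the interior of `I`").
[cite: Burkholder1991, §8, proof of (8.10)] -/
theorem norm_line_lt_one_of_between {x h : E} (hh : h ≠ 0) {p t q : ℝ} (hp : ‖x + p • h‖ ≤ 1)
    (hq : ‖x + q • h‖ ≤ 1) (hpt : p < t) (htq : t < q) : ‖x + t • h‖ < 1 := by
  have key : (q - p) * ‖x + t • h‖ ^ 2 = (q - t) * ‖x + p • h‖ ^ 2 + (t - p) * ‖x + q • h‖ ^ 2
      - ‖h‖ ^ 2 * ((q - t) * (t - p) * (q - p)) := by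
    rw [norm_add_smul_sq, norm_add_smul_sq, norm_add_smul_sq]; ring
  have hp2 : ‖x + p • h‖ ^ 2 ≤ 1 := by
    have := pow_le_pow_left₀ (norm_nonneg _) hp 2; simpa using this
  have hq2 : ‖x + q • h‖ ^ 2 ≤ 1 := by
    have := pow_le_pow_left₀ (norm_nonneg _) hq 2; simpa using this
  have hhpos : 0 < ‖h‖ ^ 2 := by positivity
  have hprod : 0 < (q - t) * (t - p) * (q - p) := by
    have := mul_pos (sub_pos.2 htq) (sub_pos.2 hpt); exact mul_pos this (by linarith)
  have hlt : ‖x + t • h‖ ^ 2 < 1 ^ 2 := by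
    nlinarith [mul_le_mul_of_nonneg_left hp2 (sub_pos.2 htq).le,
      mul_le_mul_of_nonneg_left hq2 (sub_pos.2 hpt).le, mul_pos hhpos hprod]
  exact lt_of_pow_lt_pow_left₀ 2 zero_le_one hlt

/-- `I = {t : |x + th| ≤ 1}` is convex. [cite: Burkholder1991, §8, proof of (8.10)] -/
theorem convex_lineSet (x h : E) : Convex ℝ {t : ℝ | ‖x + t • h‖ ≤ 1} := by
  intro t₁ ht₁ t₂ ht₂ a b ha hb hab
  simp only [mem_setOf_eq, smul_eq_mul] at ht₁ ht₂ ⊢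
  have e : x + (a * t₁ + b * t₂) • h = a • (x + t₁ • h) + b • (x + t₂ • h) := by
    have : x = (a + b) • x := by rw [hab, one_smul]
    conv_lhs => rw [this]
    simp only [add_smul, smul_add, smul_smul]
    abel
  rw [e]
  calc ‖a • (x + t₁ • h) + b • (x + t₂ • h)‖
      ≤ ‖a • (x + t₁ • h)‖ + ‖b • (x + t₂ • h)‖ := norm_add_le _ _
    _ = a * ‖x + t₁ • h‖ + b * ‖x + t₂ • h‖ := by
        rw [norm_smul, norm_smul, Real.norm_of_nonneg ha, Real.norm_of_nonneg hb]
    _ ≤ a * 1 + b * 1 := by gcongr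
    _ = 1 := by rw [mul_one, mul_one, hab]

/-- Lower semicontinuity (within `I`) of `G(t) = u(x + th, y + tk)` at an endpoint `|x + th| = 1`
of `I`: `G(t) ∈ {0, 1}`, `u ≥ 0` on `S`, `u = 1` near points with `|y| > λ`, and (8.9) at the
corner `|y + tk| = λ`. [cite: Burkholder1991, §8, (8.9)] -/
theorem lowerSemicontinuousWithinAt_endpoint {lam : ℝ} (hlam : 2 < lam) {x y h k : E}
    (hh : h ≠ 0) {t : ℝ} (ht : ‖x + t • h‖ = 1) :
    LowerSemicontinuousWithinAt (fun t' : ℝ => burkholderU lam (x + t' • h) (y + t' • k))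
      {t' : ℝ | ‖x + t' • h‖ ≤ 1} t := by
  intro z hz
  dsimp only at hz ⊢
  rcases lt_trichotomy ‖y + t • k‖ lam with hy | hy | hy
  · -- `G(t) = 0 ≤ G` on `I`
    have h0 : burkholderU lam (x + t • h) (y + t • k) = 0 := by
      unfold burkholderU; rw [if_pos ht, if_neg (not_le.2 hy)]
    rw [h0] at hz
    filter_upwards [self_mem_nhdsWithin] with t' ht'
    exact lt_of_lt_of_le hz (burkholderU_mem_Icc hlam ht' _).1
  · -- the corner `|y + tk| = λ`: (8.9)
    have h1 : burkholderU lam (x + t • h) (y + t • k) = 1 := by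
      unfold burkholderU; rw [if_pos ht, if_pos hy.ge]
    rw [h1] at hz
    set ε := (1 - z) / 2 with hε
    have hε0 : 0 < ε := by rw [hε]; linarith
    have hplus := corner_le_eventually hlam ht hy hh hε0 (κ := k)
    have hminus := corner_le_eventually hlam ht hy (neg_ne_zero.2 hh) hε0 (κ := -k)
    obtain ⟨δ₁, hδ₁, H₁⟩ := exists_Ioo_of_eventually hplus
    obtain ⟨δ₂, hδ₂, H₂⟩ := exists_Ioo_of_eventually hminus
    rw [eventually_nhdsWithin_iff, Metric.eventually_nhds_iff]
    refine ⟨min δ₁ δ₂, lt_min hδ₁ hδ₂, fun t' ht' hI => ?_⟩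
    simp only [mem_setOf_eq] at hI
    rw [Real.dist_eq] at ht'
    rcases lt_trichotomy t' t with hlt | heq | hgt
    · -- `t' = t - s`
      have hs : 0 < t - t' := by linarith
      have hs' : t - t' < δ₂ := by
        rw [abs_of_neg (by linarith)] at ht'; linarith [min_le_right δ₁ δ₂]
      have e1 : x + t' • h = x + t • h + (t - t') • (-h) := by rw [smul_neg, sub_smul]; abel
      have e2 : y + t' • k = y + t • k + (t - t') • (-k) := by rw [smul_neg, sub_smul]; abel
      rw [e1, e2]
      rw [e1] at hI
      have := H₂ (t - t') ⟨hs, hs'⟩ hI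
      rw [hε] at this; linarith
    · rw [heq, h1]; exact hz
    · have hs : 0 < t' - t := by linarith
      have hs' : t' - t < δ₁ := by
        rw [abs_of_pos (by linarith)] at ht'; linarith [min_le_left δ₁ δ₂]
      have e1 : x + t' • h = x + t • h + (t' - t) • h := by rw [sub_smul]; abel
      have e2 : y + t' • k = y + t • k + (t' - t) • k := by rw [sub_smul]; abel
      rw [e1, e2]
      rw [e1] at hI
      have := H₁ (t' - t) ⟨hs, hs'⟩ hI
      rw [hε] at this; linarith
  · -- `|y + tk| > λ`: `G = 1` near `t`
    have hl0 : 0 < lam := by linarith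
    have h1 : burkholderU lam (x + t • h) (y + t • k) = 1 := by
      unfold burkholderU; rw [if_pos ht, if_pos hy.le]
    rw [h1] at hz
    have hcont : Continuous fun t' : ℝ => ‖y + t' • k‖ ^ 2 - (lam ^ 2 - 1 + ‖x + t' • h‖ ^ 2) := by
      fun_prop
    have hpos : 0 < ‖y + t • k‖ ^ 2 - (lam ^ 2 - 1 + ‖x + t • h‖ ^ 2) := by
      rw [ht]; nlinarith [norm_nonneg (y + t • k)]
    have hev : ∀ᶠ t' in 𝓝 t, 0 < ‖y + t' • k‖ ^ 2 - (lam ^ 2 - 1 + ‖x + t' • h‖ ^ 2) :=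
      (hcont.tendsto t).eventually (lt_mem_nhds hpos)
    rw [eventually_nhdsWithin_iff]
    filter_upwards [hev] with t' ht' hI
    rw [burkholderU_eq_one_of_sq_lt hl0 (by linarith)]
    exact hz

/-- **Burkholder: "The function `G` is concave on `I`."** For a real inner product space `E`,
`λ > 2`, `u = burkholderU λ` (Burkholder's explicit majorant for Thm. 8.1) and `x, y, h, k ∈ E`
with `|k| < |h|`, the function `G(t) = u(x + th, y + tk)` is concave on
`I = {t ∈ ℝ : |x + th| ≤ 1}` — the concavity step of the proof of (8.10) ((8.11)–(8.16) and the
continuity of `G`). No dimension or completeness hypothesis is needed for this step.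
[cite: Burkholder1991, §8, proof of (8.10)] -/
theorem burkholderU_concaveOn_line {lam : ℝ} (hlam : 2 < lam) (x y h k : E) (hhk : ‖k‖ < ‖h‖) :
    ConcaveOn ℝ {t : ℝ | ‖x + t • h‖ ≤ 1} (fun t => burkholderU lam (x + t • h) (y + t • k)) := by
  have hh : h ≠ 0 := ne_zero_of_norm_lt hhk
  refine concaveOn_of_midpoint_le (convex_lineSet x h) ?_ ?_
  · intro t ht
    simp only [mem_setOf_eq] at ht
    rcases ht.lt_or_eq with hlt | heq
    · exact (continuousAt_line hlam hhk hlt (y := y)).continuousWithinAt.lowerSemicontinuousWithinAt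
    · exact lowerSemicontinuousWithinAt_endpoint hlam hh heq
  · intro p t q hp hq hpt htq
    simp only [mem_setOf_eq] at hp hq
    have ht : ‖x + t • h‖ < 1 := norm_line_lt_one_of_between hh hp hq hpt htq
    have := midpoint_sum_le hlam ht hhk (y := y + t • k)
    filter_upwards [this] with s hs
    rw [add_sub_smul x h t s, add_sub_smul y k t s, add_add_smul x h t s, add_add_smul y k t s]
    exact hs

end Main

end Burkholder1991

/-- **The concavity clause of `Burkholder1991_keyFunction`, proved.** For every real inner
product space `E` (in particular every real Hilbert space of dimension `≥ 2`), `λ > 2`, and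
`x, y, h, k ∈ E` with `‖x‖ ≤ 1`, `‖x + h‖ ≤ 1`, `‖k‖ < ‖h‖`, the function
`t ↦ u_λ(x + th, y + tk)` is concave on `{t : ‖x + th‖ ≤ 1}` — Burkholder, LNM 1464, §8, proof
of (8.10): "The function `G` is concave on `I`. This follows from (8.15), (8.16), and the
continuity of `G`."  This is exactly the third component of the tree's named fact
`Burkholder1991_keyFunction` (and the `ℝ⁶` instance is the pub-nsfunc cell's typed hypothesis
`Laminate.BurkConcave`). [cite: Burkholder1991, §8, proof of (8.10)] -/
theorem burkholderU_concaveOn {E : Type*} [NormedAddCommGroup E] [InnerProductSpace ℝ E]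
    {lam : ℝ} (hlam : 2 < lam) :
    ∀ x y h k : E, ‖x‖ ≤ 1 → ‖x + h‖ ≤ 1 → ‖k‖ < ‖h‖ →
      ConcaveOn ℝ {t : ℝ | ‖x + t • h‖ ≤ 1} (fun t => burkholderU lam (x + t • h) (y + t • k)) :=
  fun x y h k _ _ hk => Burkholder1991.burkholderU_concaveOn_line hlam x y h k hk

end Literature.Probability.Process

end
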